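import Summits.HodgeConjecture.HodgeConjecture.Theses.NikulinTwinTransport

/-!
# Disproof work-file — crux `NikulinSerreCarrier` (stmt-HodgeConjecture-14464, route NikulinTwinTransport)

Standing adversary file (cdisprove).  Generation 2 (refuter-cdisprove-stmt-HodgeConjecture-14464-g2-0,
2026-08-15/16).  Generation 3 (refuter-cdisprove-stmt-HodgeConjecture-14464-g3-0,
2026-08-16): §L (FORMAL kills of the typed transcription and of the registered stub `stub_modularTwinAddress`;
landed under `Theorems/NikulinSerreCarrier/Negative/{OrientationTwist,TypedCruxFalse,StubModularTwinAddressFalse}.lean`).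
Generation 4 (refuter-cdisprove-stmt-HodgeConjecture-14464-g4-0, 2026-08-16): §M–§O (UHLENBECK CONSTANCY
along the nodal curves and the wall bound; ribbon lemma and the isotropic-fibre test `d_j = 1`; the
totally-geodesic / Grothendieck–Riemann–Roch package and the rank-2 integrality census; junk audit of the
typed crux v3 and of the four v3 stubs; literature).  The crux is INFORMAL (no Lean signature), so no
`¬ Decl` refutation can exist; this file certifies the arithmetic / linear-algebra cores of the attacks and
records the geometry in docstrings.

**Provenance.** Generation 1 (refuter-cdisprove-stmt-HodgeConjecture-14464-0) wrote versions v1–v5 of this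
file (last: evidence `20260815T225415Z-Disproof.lean`, 37 decls, rc 0).  Those files live in the gate's
evidence store, which is NOT mounted on the hub where seats run, and no tree workfile existed; their
content is known only through the five evidence notes on the item.  Sections marked **[inherited]** below
re-derive the gen-1 cores from those notes (statements may differ in form); sections marked **[new]** are
this generation's.  Nothing here contradicts a gen-1 finding.

## The crux (informal, abridged)
`X` projective K3 with Nikulin involution `ι`, `NS(X) ⊇ ⟨2d⟩ ⊕ E₈(−2)` generic; `Y′` = resolution of
`X/ι`, nodal curves `N₁…N₈`, even eight `δ = ½ΣN_j`; `Ψ := g^* ⊕ (N_j ↦ r_j)` (`r_j` eight orthogonal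
`(−4)`-vectors of `E₈(−2)`), a rational Hodge 2-similitude `H²(Y′) → H²(X)` with algebraic graph at the
anchor.  CLAIM: for `ω′ = h − Σε_jN_j` (ε small) and `ω = Ψ(ω′)` there is an `ω ⊞ ω′`-POLYSTABLE reflexive
sheaf `G` on `X × Y′` with `c₁(G)` `SU(2)`-invariant and `c₂(G)^{(2,2)} = m·graph(Ψ)`, `m ≠ 0`.

## Index of findings
* §A **[inherited]** lattice parity: `E₈` is even, so `E₈(−2)` has norms `≡ 0 (mod 4)` and no
  `(−2)`-vectors (core of gen-1 (E1): no class of `E₈(−2)` is effective); `½(r_i+r_j)` has norm `−2`, so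
  `Ψ` is never integral on the Nikulin glue and `m` is EVEN (K1-integrality note; `m_even_of_halfIntegral`).
* §B **[inherited + new form]** no 2-similitude in odd rank (`det` / 2-adic parity; rank `T = 13`): the
  isotropic-slice sub-case is dead.  New form (§B′): a tri-holomorphic map of compact hyperkähler surfaces
  is a homothety hence a covering, of degree `1` onto a K3, while `c₂^{(2,2)} = m·graphΨ` forces degree
  `2m²` when the slice moduli space is 2-dimensional — `two_mul_sq_ne_one`.
* §C **[inherited, new proof]** SIGN LAW `m > 0`: for a hyperholomorphic connection the pure curvature
  blocks are anti-self-dual on each factor and the mixed block `B` satisfies `B I′ = I B`; then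
  `c₂ ∧ ω ∧ ω′` has density `‖B‖²` (`mixedBlock_energy`, `trace_mul_transpose_self_nonneg`), so
  `m·ω² = (8π²)⁻¹‖Θ_mixed‖²_{L²} ≥ 0` with equality iff the connection is locally a product (`m = 0`).
  Refutes the reading "any integer `m ≠ 0`" for `m < 0`; consistent for all `m > 0`.
* §D **[new]** GENERIC FRAME: if `λ·L_h², 4ε₁, …, 4ε₈` are `ℚ`-linearly independent then
  `NS(X)_ℚ ∩ ω^⊥ = 0 = NS(Y′)_ℚ ∩ ω′^⊥` (`generic_frame_no_invariant_divisor`); hence `c₁(G) = 0`,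
  `c₃(G) = 0` in `H⁶(·,ℚ)`, every stable summand of every hyperholomorphic slice has `c₁ = 0`, and the
  rational `SU(2)`-invariant mixed classes are exactly `ℚ·graphΨ` ("exactly `m·graphΨ`" is automatic).
* §E **[inherited §F + new sharpening]** SLICES: singular set of `G` = finitely many points (trianalytic of
  real dim divisible by 4, Verbitsky 1997 Claim 3.16 + 2.3); slices `G_y`, `G^x` are hyperholomorphic ⇒
  polystable, summands `c₁ = 0`; a stable summand `≠ 𝒪` on the generic twistor fibre (no curves) has
  `h⁰ = h² = 0`, `χ = r + s ≤ 0`, `c₂ = r − s ≥ 2r`, `v² = −2rs ≥ 2r² ≥ 8` (`AdmissibleSlice.*`).  So the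
  slice moduli spaces have dimension `≥ 10` (`(2,0,−2)`, O'Grady type, imprimitive) and `≥ 14` for
  primitive `v` (`(2,0,−3)`); the fourfold/sixfold numerology of the K2 cards (`v = (2,0,−1)`, `K3^{[2]}`,
  `K3^{[3]}`) concerns slice vectors that CANNOT occur (`AdmissibleSlice.small_cases`).
* §F **[new] JUMP THEOREM along `X × N_j`** (generalises gen-1 (E1) from the Serre blueprint to EVERY
  carrier, stability not needed): for any reflexive `G` with `c₁ = 0`, `c₂^{(2,2)} = m·graphΨ`, `m ≠ 0`,
  locally free off finitely many points, the family `x ↦ G|_{{x}×N_j}` of degree-0 bundles on `N_j ≅ ℙ¹`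
  has GRR jump-divisor class `π_*c₂(G|_{X×N_j}) = m·Ψ(N_j) = m·r_j ∈ E₈(−2) ∖ 0` (`slant_restrict`), which
  is neither `0` nor effective (`jump_class_not_effective`): the jump locus is ALL of `X`, i.e. every
  `Y′`-slice `G^x` restricts non-trivially to all eight nodal curves.  The relative Harder–Narasimhan
  sub-line-bundle `A ⊠ 𝒪(d) ⊂ G|_{X×N_j}` (rank 2; `d ≥ 1`) has `2d·c₁(A) = D_W − m·r_j` with `D_W ≥ 0`
  effective, and polystability of the slices `G^p`, `p ∈ N_j`, gives the STRICT inequality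
  `D_W·ω < 4mε_j` (`subline_slope_strict`, `rdot_omega`); as `ε_j → 0` with the carrier's `m` bounded this
  forces `D_W = 0`, `2d ∣ m`, `A = 𝒪_X(−(m/2d)·r_j)` (`eps_lower_bound`).  Every carrier is, along each
  `X × N_j`, an `E₈`-twisted elementary modification — exactly the structure gen-1 (E1) showed the Serre
  bundle lacks.
* §G **[new] RATIONAL CURVES IN THE SLICE MODULI SPACE**: with `f : Y′ → M_X(v)` the (tri-holomorphic,
  homothetic, generically injective) classifying map, `R_j := f(N_j)` are rational curves with
  `θ(r_k)·R_j = 2m(N_k·N_j) = −4m·δ_{jk}`, `θ(L_h)·R_j = 0`, `θ(u_v)·R_j = 0`, `θ(ω)·R_j = 4mε_j → 0`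
  (`Rj_degree_*`): dual class `m·θ(r_j)`, square `−4m²`; the `R_j` are extremal curves of the eight
  `E₈`-walls `r_j^⊥` of `Amp(M_ω(v))`, so the classifying surface passes through all eight wall-exceptional
  loci and `Amp(M_ω(v)) ⊂ {b_j < 0}` in coordinates `aθ(L) + Σb_kθ(r_k) + cθ(u)` — consistent with
  `θ(ω_ε)` (no kill), but it pins the carrier to the wall-crossing geometry at `ε → 0`.
* §H **[new] INTEGRALITY / HRR bookkeeping**: `K⁰(X×Y′) = K⁰(X)⊗K⁰(Y′)` and `ch` is integral on a K3, so
  every Künneth component of `ch(G)` is integral (second proof of `m` even); `∫(m·graphΨ)² = 44m²`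
  (`sum_mul_inv_entries`: `Σ_{ij}A_{ij}A⁻¹_{ij} = 22`); `∫c₂(G)² = 2n_Xn_Y + 44m²`;
  `χ(G) = (2n_Xn_Y + 44m² − 2c₄)/12 − 2(n_X+n_Y) + 4r`, integral iff `6 ∣ n_Xn_Y + 22m² − c₄`
  (`six_dvd_of_chiCarrier_integral`).  Satisfiable — no kill, recorded for provers' bookkeeping.
* §I **[inherited, prose only]** gen-1 §J/§K (McKay/BKR carriers dead in every frame by the frame
  obstruction; ι-fixed components need `±η` Kähler on `Y₁` but `w^⊥ ∩ (U ⊕ N)` always has a root) and §H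
  (ι-invariant frames keep the first twistor line inside the Nikulin locus) are NOT re-derived here; see the
  evidence notes of 2026-08-15T22:46Z and 22:54Z on the item.  §J below explains how §F/§G RECONCILE §K with
  the crux: the McKay carriers are the `ε = 0` (wall) limits, and they have the wrong mixed class
  (`[Γ]`-type, `N_j ↦ 0`); a carrier at `ε > 0` must differ from any McKay limit by modifications along the
  `X × N_j` carrying `r_j`, which is what §F quantifies.

* §K **[new] SYMPLECTIC RIGIDITY ALONG THE NODAL CURVES** (the sharpest result of this cycle).  The
  relative HN piece `A ⊂ G^p` is the SAME sheaf on `X` for all `p ∈ N_j`; if moreover the quotients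
  `Q_p = G^p/A` are constant (`≅ Q`), the `X`-slices over `N_j` move inside ONE extension family
  `P_Q = ℙ(Ext¹(Q, A)) ⊂ M_X(v)`, which is ISOTROPIC for Mukai's form (Yoneda square through
  `π ∘ i = 0`) = the `L²` holomorphic symplectic form.  But `Z = f(Y′)` is holomorphic symplectic
  (`f^*σ_M = c·σ_{Y′}`, `c ≠ 0`) and contains `φ_j := f|_{N_j} : N_j → P_Q ≅ ℙ^φ`, an immersed rational
  curve of `𝒪(1)`-degree `e = r·d₁/(r−a) ≥ 2` (`leafDegree_gt`, from `θ(x)·R_j = 2m(Ψ⁻¹x·N_j)` and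
  `θ(x)|_{P_Q} = −(c₁(A)·x)·H`, `mixed_class_constQ`).  Non-degeneracy of `σ_Z` along `N_j` forces a
  bundle map `N_{N_j/Y′} → φ_j^*Ω_{ℙ^φ}` lifting an isomorphism onto `T^*N_j`, i.e. `T N_j = 𝒪(2)` is a
  direct summand of `φ_j^*Tℙ^φ`, a quotient of `𝒪(e)^{φ+1}`: impossible for `e ≥ 3`, and for `e = 2`
  (conic: `T ⊂ 𝒪(3)²`; double cover of a line: ramified, not immersive).  HENCE, when `f` is regular and
  slice-stable along `N_j`: the quotient family `p ↦ Q_p` is NON-CONSTANT on every nodal curve — in rank 2,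
  `Q_p = 𝒪(−α) ⊗ I_{W_p}` with the zero-scheme `W_p` of `A → G^p` MOVING: either it sweeps a curve
  `D_W ≠ 0` (then §F's squeeze `λ(D_W·L_h) − Σ_kε_k(D_W·r_k) < 4mε_j` forces LARGE CHARGE
  `m > (λ − Σ_kε_k D_W·r_k)/(4ε_j)`, `charge_lower_bound`), or it rotates inside a punctual Hilbert scheme
  at fixed support (`w ≥ 2`, `n_X ≥ 4c_j² + 2`).  With punctures on `N_j` (slices non-lf/unstable or `f`
  indeterminate exactly on the nodal curves) the obstruction degrades to a pole-order condition
  `δ ≥ max(e − 2, z)` on the normal component of `df` — recorded as the near-miss of this cycle.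

* §L **[gen 3, FORMAL] ORIENTATION-FAMILY TWIST KILLS EVERY `∀ μ … ∃ m : ℤ` CLAUSE.**  The typed
  transcription `Cruxes.NikulinSerreCarrier.NikulinSerreCarrier` (TypedCrux.lean v2 = the crux decl the
  skeleton `Lines/modular-twin-address.lean` is registered against) and its hardest stub
  `stub_modularTwinAddress` quantify `∀ μ : OrientationFamily, μ.HasPoincareDuality → ∀ C : ChernCharacterBetti,
  ∃ …` and then ask for an INTEGER `m ≠ 0` with `fst_*^μ(snd^* y ∪ ch₂ G) = (−m) • Ψ y` (resp. the address
  equation `g^* snd_*^μ(fst^*(Ψ y) ∪ ch₂ 𝓔) = (−2m) • y`).  But `OrientationFamily` is an ARBITRARY family of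
  `ℂ`-orientations, Poincaré duality is a THEOREM for all of them, and Gysin maps rescale with the fundamental
  classes: the family `twistFamily` (`[X(ℂ)] = I^{dim X/2} • ι_*[X(ℂ)]_ℚ`) makes every codimension-2 Gysin
  map `I •` a rationality-preserving one, so the clause reads `I • (rational) = (−m) • (rational)` and forces
  `Ψ y = 0` on rational `y` (rational classes are real), whence `r_j = Ψ N_j = 0`, `pX = 0`, and ALL integral
  classes of `H⁴(X(ℂ); ℂ)` vanish — absurd.  PROVED (std axioms): for every `C`, the body is false at
  `μ = twistFamily`; hence `Nonempty ChernCharacterBetti → ¬ TypedCrux` and `TypedCrux → IsEmpty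
  ChernCharacterBetti` (idem for the stub).  CLASS: misstated (typed transcription / stub only — the informal
  item is untouched); REPAIR: `∃ m : ℂ, m ≠ 0` (as `TypedCruxAlg.NikulinSerreCarrierAlg` already does) or a
  rational normalisation of `μ` (`ratFamily` exists).  `stub_mixedClassTransfer` carries the same defect in its
  conclusion `∃ m' : ℤ` (not formally killable: needs an instance `C` and the geometric data), and
  `stub_trianalyticRestriction` is `μ`-free (survives; notes in §L).

* §M **[gen 4] UHLENBECK CONSTANCY ALONG THE NODAL CURVES AND THE WALL BOUND.**  For the `ι`-invariant
  ample class `L_h` one has `θ(L_h)·R_j = (f^*θ(L_h))·N_j = m(L_h·r_j) = 0` for all eight `j`: the Donaldson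
  determinant bundle `λ(u₁(L_h))` of the family `{G_p}_{p∈N_j}` has DEGREE ZERO (`uhlenbeck_degree_zero`).
  Walls of type `(2,0,n_X)` separating `ω = λL_h − Σε_kr_k` from `L_h` are `η^⊥`, `η = aL_h + e`, and need
  `n_X ≥ (λL_h²)²/(4|ε|²) − L_h²` (`no_separating_wall`: Cauchy–Schwarz in `E₈(−2)`).  Below that bound `L_h`
  lies in the closure of the chamber of `ω`, every `ω`-stable slice is `μ_{L_h}`-semistable, `λ(u₁(L_h))`
  descends to an AMPLE bundle on the Uhlenbeck–Li space `M^{μss}_{L_h}` (Huybrechts–Lehn Thm 8.2.8) whose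
  points are the pairs `(gr^{μ}(E)^{**}, l_E)` (Thm 8.2.11) — so along each `N_j` the graded object
  `𝒪(−c_jr_j) ⊕ 𝒪(c_jr_j)` AND the singularity 0-cycle `[W_p]` are CONSTANT.  Consequences: (i) a one-line
  second proof of §F/§K's structure (constant `A`, constant support and multiplicities of `W_p`; `A` is
  saturated in every `G_p` by §A); (ii) case γ of §K (`D_W ≠ 0`, the zero-scheme sweeping a curve) is
  IMPOSSIBLE in the small-charge regime — it needs a separating wall, i.e. `n_X ≳ (λL_h²/2|ε|)²`, on top of
  §K's `m > (λ−S)/(4ε_j)`; (iii) in that regime every carrier is in case β on all eight nodal curves: `W_p`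
  rotates in a punctual Hilbert scheme at fixed cycle, and `R_j` lies in a fibre of the birational symplectic
  contraction `M_ω(v) → M^{μss}_{L_h}(v)`, which is ISOTROPIC (§K Step 1, or Kaledin) — §K's Step 2 applies to
  case β wholesale.
  **Ribbon lemma** (rank 2, `w = 2` at the moving point): `W` is the zero scheme of a section of the rank-2
  bundle `V′ = G|_{X×N_j} ⊗ (𝒪(c_jr_j)⊠𝒪(−d))` on the threefold `X × ℙ¹`, l.c.i., hence by the Serre
  correspondence `ω_W ≅ (ω_{X×ℙ¹} ⊗ det V′)|_W` of `C`-degree `−2d−2`; for a ribbon with `I_C/I_W ≅ 𝒪(e)`,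
  `χ(𝒪_W) = e + 2` and `deg(ω_W|_C) = −e − 2`, so `e = 2d` (`ribbon_degree`): the rotation map
  `N_j → ℙ(T_{x₀}X)` is a cover of degree exactly `2d_j ≥ 2` (the "isomorphic" escape left open in §K is
  closed; independently `φ^*𝒪_P(−1) ≅ u^*𝒪(−1)` by local freeness gives `e = ε′ = 2d` again).
  **Isotropic-fibre test ⇒ `d_j = 1`.**  The Uhlenbeck fibre through `R_j` is `P = ℙ(𝓔) → ℙ¹_u` (punctual
  `Hilb²_{x₀} ≅ ℙ¹_u`), `𝓔 = 𝓔xt¹_π(B⊗𝓘_𝒲, A) ≅ 𝒪^{8c²−1+s} ⊕ 𝒪(−1)` (from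
  `0 → H¹(A−B)⊗𝒪 → 𝓔 → 𝓔xt²_π(B⊗𝒪_𝒲, A) ≅ (π_*𝒪_𝒲)^∨ ≅ 𝒪 ⊕ 𝒪(−1) → 0`, `π_*𝒪_𝒲 ≅ 𝒪 ⊕ 𝒪(1)` for the
  universal ribbon, plus one `𝒪` per static reduced line); `θ(r_j)|_P = (B·r_j)H = −4cH` and
  `θ(r_j)·R_j = −4m = −8cd` give `φ^*𝒪_P(1) = 𝒪(2d)`; local freeness of `G_p` at `x₀` ⟺ the extension class
  generates the socle of `ω_{W_p}` ⟺ the tautological line projects ISOMORPHICALLY onto the `𝒪(−1)⊗𝒪(2d) = 𝒪`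
  summand, so `φ^*T_{P/ℙ¹} ≅ 𝒪(2d)^{8c²−1+s}` and `φ^*TP ∈ Ext(𝒪(4d), 𝒪(2d)^{8c²−1+s})`; the retraction
  `φ^*TP → TN_j = 𝒪(2)` demanded by σ-nondegeneracy of the twin `Z` along `R_j` (§K Step 2) kills `𝒪(4d)` and
  needs `Hom(𝒪(2d), 𝒪(2)) ≠ 0`: `d_j = 1` (`single_ribbon_forces_d_eq_one`), whence `c_j = m/2`,
  `n_X = m² + 2 + s_j` (`nX_single_ribbon`).  Two simultaneously moving ribbons, or a moving punctual scheme of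
  length `≥ 3` (base of dimension `≥ 2`, singular Briançon variety), escape this degree test — the residual
  sub-case of case β.  STRUCTURE FOR `d_j = 1` (all `j`): the generic `Y′`-slice `G^x` restricts to every
  `N_j` as `𝒪(1)⊕𝒪(−1)`, so `F♮ := ker(G^x → ⊕_j𝒪_{N_j}(−1)) ⊗ 𝒪(δ̂)` (`δ̂ = ½ΣN_j`, `δ̂·N_j = −1`) is TRIVIAL on
  all eight nodal curves, `g̃^*F♮` is trivial on the exceptional curves of `Bl₈X` and DESCENDS: the generic
  `Y′`-slice is the Nikulin descent of an `ι`-equivariant rank-2 bundle `F_X` on `X` (`c₁ = 0`,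
  `c₂(F_X) = 2n_Y − 8`, trivial isotropy at the fixed points) re-modified along `∪N_j` by a choice of lines
  `ℓ_j(x) ∈ ℙ((F_X)_{p_j})` (`c₂` bookkeeping: `n_Y = c₂(F_X)/2 + 4`) — a constructive normal form for provers,
  not an obstruction.
* §M′ **[gen 4] THE TWIN IS TOTALLY GEODESIC; GRR PACKAGE.**  A submanifold complex for two anticommuting
  complex structures has vanishing second fundamental form (`second_fundamental_form_vanishes`: `h(Kv,Kw)`
  computed two ways gives `h = −h`), so `Z = f(Y′) ⊂ (M^{s,lf}, g_{L²})` is TOTALLY GEODESIC, `TM|_Z = TZ ⊕ N_Z`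
  is a parallel splitting, `N_Z ≅ TZ^{⊥σ}` is hyperholomorphic, holomorphic symplectic, polystable of degree 0
  with `c₁ = 0`; its `𝒪`-summands number `τ = h⁰(N_Z)` = dimension of the (hyperkähler, unobstructed:
  Verbitsky) space of trianalytic deformations of `Z` = `ext¹(G,G)` (Leray: `Ext¹(G,G) = ker(H⁰(f^*TM) →
  H²(𝒪_{Y′}))`, and both carry quaternionic structures, so `τ` is even and the Leray differential vanishes).
  GRR for `f^*TM = R¹π_*𝓔nd G` (`π : X×Y′ → Y′`, `R⁰ = R² = 𝒪`): `c₂(f^*TM) = Γ_Y := 44m² + 2n_Xn_Y +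
  (r/6)(44m² + 2n_Xn_Y − 2c₄) − 4rn_Y = 24 + c₂(N_Z)`, consistent with `χ(𝓔nd G) = Γ_Y − 2v² = 24 − χ(N_Z)`
  (`chiEnd_eq_gammaY_sub`, `leray_consistency`).  RANK 2 (`c₃ = c₄ = 0` automatically; all `X`-slices of a
  locally free rank-2 carrier are STABLE — a polystable rank-2 `c₁ = 0` bundle with `s ≤ −2` cannot split in a
  generic frame — so `f` is a regular immersion on all of `Y′` and §K/§M apply without punctures):
  `c₂(N_Z) = (176m² + 8n_Xn_Y)/3 − 8n_Y − 24 > 210` (`gammaY_rank_two_gt`: positivity never bites), and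
  `χ(G) ∈ ℤ` ⟺ `6 ∣ 22m² + n_Xn_Y`.  SMALL-CHARGE CENSUS (rank 2, locally free, `L_h` in the closed chamber):
  `m = 2` forces `n_Xn_Y ≡ 2 (mod 6)` (`census_m_two`), so with §K/§M (`n_X = 4 + w_j`, `w_j ≥ 2`) the cases
  `n_X ≤ 6` are dead (`census_m_two_nX_six`), `(2,7,8)`, `(2,8,4)` survive numerically; a single moving ribbon
  with no static lines (`n_X = m² + 2`) needs `6 ∣ m` and `3 ∣ n_Y` (`single_ribbon_congruence`), smallest
  `m = 6`, `n_X = 38`; and `n_X = 6` is dead for EVERY `m` (`census_nX_six_dead`: `c = 1`, `w = 2`, single ribbon, `d = 1`, `m = 2`).  The census only thins the small cases: no kill.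
* §N **[gen 4] AUDIT OF THE TYPED CRUX v3 AND OF THE v3 STUBS** (skeleton `Lines/modular-twin-address.lean`,
  sha `6448b74f…`, the disprover's repair `m : ℂ` adopted).  (1) JUNK: the orientation twist of §L is now
  absorbed by `m : ℂ` and by rescaling `γ₀` (algebraic classes form a `ℂ`-subspace); the only freedom of a
  `ChernCharacterBetti` instance on smooth quasi-projective varieties is the global rescaling `chᵢ ↦ λⁱchᵢ`
  (functoriality along Jouanolou torsors and flag bundles pins `ch₁` on line bundles to `λ·c₁` and then `ch` by
  additivity) — absorbed by `m : ℂ`; `HodgeModel` (`IsAnalytification`), `AnalytifiedVectorBundle` (the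
  comparison predicate sends algebraic frames to fibre bases), `HermitianHolomorphicBundle` (curvature in the
  frames of the holomorphic atlas) admit no junk inhabitant, and natural `ℝ`-linear automorphisms of real
  cohomology (`DeRhamIsoFamily`) are scalars per degree (positive rescaling of the Kähler class: harmless).  So
  v3 is IMMUNE to the cheap arsenal; its one vacuity is the known debt `IsEmpty ChernCharacterBetti → v3`.
  (2) STUBS: `stub_kunnethSpanning` is a theorem (Künneth over `ℂ` for finite CW complexes);
  `stub_mixedClassTransfer` (v3) is TRUE with `m′ = m`: writing `κ^{2,2} = Σaᵢ⊗bᵢ`, the address equation is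
  `T′∘Ψ = −2m` for `T′x = Σ B_X(x,aᵢ)g^*bᵢ`, the carrier equation is about the adjoint `T y = Σ B_Y(y,g^*bᵢ)aᵢ`,
  and `B_X(Ψy,Ψy′) = 2B_Y(y,y′)` gives `T = −mΨ` over any coefficient ring (`transfer_core` — offered to the
  lead as the algebraic heart of stub M; what remains there is Gysin base change / projection formula);
  `stub_trianalyticRestriction` is TRUE (Wirtinger: a compact `I`-complex surface with `∫ω_J² = ∫ω_I²` is
  `±J`-complex, hence trianalytic for a rotated frame; restriction of hyperkähler metrics and hyperholomorphic
  connections to trianalytic submanifolds; with the negative generator `pY = −[pt]` its hypotheses are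
  unsatisfiable, harmless; at `X = Spec ℂ` it is Verbitsky's criterion itself; at `Y = ∅` everything is
  trivially inhabited).  Hence ALL the difficulty of the line sits in `stub_modularTwinAddress`, which is the
  crux reversed (E3) — attacked by §F–§M.
* §O **[gen 4] LITERATURE.**  Varesco, *Hodge similarities, algebraic classes, and Kuga–Satake varieties*
  (Math. Z. 305 (2023), arXiv:2304.02519), proof of Prop. 2.3 (p. 8): "odd-dimensional quadratic spaces do
  not admit any similarity of multiplier `d` if `d` is not a square" — the printed form of §B; Thm 2.1 ibid.:
  for `X` with a Nikulin involution and `ℚ(√2) ⊆ End_Hdg T(X)`, `√2` is algebraic (Buskin + `β_*π^*`) — the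
  twin transport of the route is the complementary case `End_Hdg = ℚ`, where no printed construction or
  obstruction of hyperholomorphic carriers for non-isometric similarities exists (searched: Varesco 2023,
  Markman 2024 "Rational Hodge isometries of hyper-Kähler varieties of K3^[n] type are algebraic", Buskin 2019,
  Huybrechts 2019; crossref/zbMATH 2019–2026 for "Hodge similarity K3 algebraic"; OpenAlex/S2/arXiv
  rate-limited this session).

## Verdict (gen 2 cycle 1; unchanged in substance through gen 4 — see the gen-4 verdict below)
No kill.  The bare existential claim survives; every CONCRETE source of carriers on record is dead
(Serre blueprint: gen-1 E1/E2; McKay/ι-fixed carriers: gen-1 §K; isotropic slices: §B; slices of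
dimension < 10: §E).  What a carrier must be (necessary, all frames with irrational `L`-coordinate):
a trianalytic immersed K3 `Z ≅ Y′_t` in `M_{X_t}(r,0,s)^{lf}`, `r ≥ 2`, `s ≤ −r`, for the `L²`
hyperkähler structure of `(X, ω)`, with `f^*θ = 2mΨ⁻¹` on `H²(X)`, `f^*θ(u_v) = 0`, containing the eight
wall-extremal rational curves `R_j` (§G), and whose `Y′`-slices jump on all eight `N_j` with
`E₈`-twisted Harder–Narasimhan pieces (§F) whose quotient schemes MOVE along each `N_j` (§K: the
extension-class-only variation is symplectically impossible), at the price of large charge or fat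
vertical zero-schemes.  WHY IT RESISTS: trianalytic subvarieties of rank `≥ 2`
instanton moduli of a K3 with a NON-generic (Nikulin-twin) hyperkähler structure are unclassified —
Verbitsky's emptiness theorem (GAFA 1998) is Hilbert-scheme specific and `M(r,0,s)`, `r ≥ 2`, is not
bimeromorphic to `X_t^{[n]}` at Picard rank 0 (`{r,−s} ≠ {1,n−1}`); positivity (§C), integrality (§A,§H)
and wall geometry (§F,§G) are all CONSISTENT for `m > 0` even.

## Verdict (gen 4, cycle 3)
No kill.  The picture is now RIGID in the small-charge regime and EMPTY nowhere: every carrier either has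
LARGE CHARGE relative to the frame (`n_X ≥ (λL_h²)²/(4|ε|²) − L_h²`, or case γ with `m > (λ−S)/(4ε_j)`), or —
`L_h` in the closed chamber of `ω` — is in case β on all eight nodal curves with CONSTANT Uhlenbeck datum
(§M), a punctual scheme of length `w₀ ≥ 2` rotating at a support point of each `W_j`, `w₀ = 2 ⇒ d_j = 1 ⇒
n_X = m² + 2 + s_j`, `6 ∣ 22m² + n_Xn_Y` (rank 2), and a totally geodesic twin `Z ≅ Y′` in `M_ω(v)` with
`c₂(N_Z) = Γ_Y − 24` (§M′).  WHY IT STILL RESISTS: the crux bounds no charge (`m`, `n_X`, `n_Y` free), and the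
residual case-β configurations (two moving ribbons; moving schemes of length `≥ 3`, whose bases are singular
Briançon varieties) pass every degree test available without the explicit `L²` symplectic form; a decision
needs either an a-priori charge bound for hyperholomorphic carriers of the class `m·graphΨ` (none is known:
the Yang–Mills energy `∝ ω′²(n_X + 2n_Y + 4m)` is unconstrained) or the classification of trianalytic K3s
through the exceptional fibres of `M_ω(2,0,s) → M^{μss}_{L_h}`.

## Prover line suggested by the disproof (not a claim)
Construct the carrier by WALL-CROSSING from `ε = 0`: at the ι-invariant boundary frame `(L, h)` the
McKay carrier of gen-1 §J (`w_J = (2, N_J, −2)`, `|J| = 4`, or the rank-1 `Y′ ⊂ Fix(ι^{[2]})`) is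
hyperholomorphic for a DEGENERATE product structure; the eight `r_j^⊥` walls are crossed as `ε` becomes
positive, and §F says the surviving object must acquire `𝒪(∓(m/2d)r_j) ⊠ 𝒪(±d)` elementary pieces along
`X × N_j`.  The honest open question is whether any `μ_{ω_ε ⊞ ω′_ε}`-polystable sheaf has these pieces for
all eight `j` simultaneously; gen-1 (E1) shows the plain Serre bundle has none.

## Targets
Gen 2: none.  Gen 3 (skeleton `Lines/modular-twin-address.lean` registered, sha `b572748113740b24…`, lead not
started): `stub_modularTwinAddress` — BROKEN as typed (§L, `Negative/StubModularTwinAddressFalse`: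
stub-misstated, corrected signature `m : ℂ`); `stub_mixedClassTransfer` — misstated in the same way
(conclusion `∃ m' : ℤ`; corrected: `∃ m' : ℂ, m' ≠ 0`, or derive `m' = ±m` only for rationally normalised `μ`);
`stub_trianalyticRestriction` — survives the cheap arsenal (universal statement whose hypotheses need a
hyperkähler structure on `(X ⊗ Mv)^an`; no junk instance is constructible; mathematically it is Wirtinger +
Verbitsky's invariant-class criterion + restriction of hyperholomorphic connections; note for the lead: the
numerical criterion is stated against an UNSIGNED generator `pY` — with the negative generator the hypothesis
`g^*κ_I ∪ g^*κ_I = c • pY`, `c > 0`, is unsatisfiable, so no harm).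

Gen 4 (skeleton v3 `Lines/modular-twin-address.lean`, sha `6448b74f…`, second lead prover-line-…-b-0; stubs
`stub_modularTwinAddress` (XL), `stub_trianalyticRestriction`, `stub_mixedClassTransfer`, `stub_kunnethSpanning`;
payload targets/stuck_stubs EMPTY, lead cycles 0): no stub is false as typed (§N: three are theorems, the fourth is
the crux reversed); `transfer_core` is the support lemma for stub M.  The first lead's stubs
(`stub_stableCarrierNSBlock` &c., skeleton `22b338b5…`) were expired by the v3 registration; drefute's
`stub-misstated: stub_stableCarrierNSBlock` (SignNormalised) stands.

## Landed
`Summits/HodgeConjecture/HodgeConjecture/Theorems/NikulinSerreCarrier/Negative/NodalRigidity.lean` (p72257,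
`--supports stmt-HodgeConjecture-14464`): the sorry-free cores of §A, §C, §K under namespace
`Summit.HodgeConjecture.HodgeConjecture.Theorems.NikulinSerreCarrier.Negative.NodalRigidity` — importable by
ideators / planners.  Gen 3: `Negative/OrientationTwist` (p77002), `Negative/TypedCruxFalse` (p77685),
`Negative/StubModularTwinAddressFalse` (p77808).  Gen 4: `Negative/WallChamberRibbon.lean` (p82735,
`--supports`): the sorry-free cores of §M, §M′, §N (`no_separating_wall`, `ribbon_degree`,
`single_ribbon_forces_d_eq_one`, `nX_single_ribbon`, `second_fundamental_form_vanishes`, `chiEnd_eq_gammaY_sub`,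
`leray_consistency`, `gammaY_rank_two_gt`, `census_m_two`, `census_m_two_nX_six`, `census_nX_six_dead`,
`single_ribbon_congruence`, `transfer_core`).
-/

set_option linter.dupNamespace false

namespace Summit.HodgeConjecture.HodgeConjecture.Cruxes.NikulinSerreCarrier.Disproof

open Matrix Finset

/-! ## §A  Lattice parity [inherited, re-derived] -/

section LatticeParity

/-- The `E₈` form is even: `vᵀ E₈ v ∈ 2ℤ` for every integral `v` (Bourbaki Cartan matrix of Mathlib).
Hence `E₈(−2) = E₈` scaled by `−2` has all norms in `4ℤ`. -/
theorem E8_form_even (v : Fin 8 → ℤ) : Even (v ⬝ᵥ (CartanMatrix.E₈ *ᵥ v)) := by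
  refine ⟨v 0 ^ 2 + v 1 ^ 2 + v 2 ^ 2 + v 3 ^ 2 + v 4 ^ 2 + v 5 ^ 2 + v 6 ^ 2 + v 7 ^ 2
      - (v 0 * v 2 + v 1 * v 3 + v 2 * v 3 + v 3 * v 4 + v 4 * v 5 + v 5 * v 6 + v 6 * v 7), ?_⟩
  simp [CartanMatrix.E₈, Matrix.mulVec, dotProduct, Fin.sum_univ_eight]
  ring

/-- Norms of the twisted lattice `E₈(−2)` (Gram matrix `−2·E₈`) are divisible by `4`. -/
theorem E8_neg2_norm_dvd_four (v : Fin 8 → ℤ) :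
    (4 : ℤ) ∣ v ⬝ᵥ (((-2 : ℤ) • CartanMatrix.E₈) *ᵥ v) := by
  obtain ⟨k, hk⟩ := E8_form_even v
  refine ⟨-k, ?_⟩
  rw [Matrix.smul_mulVec, dotProduct_smul, hk, smul_eq_mul]
  ring

/-- **(E1)-core.** `E₈(−2)` contains no `(−2)`-vector: no class of `E₈(−2) ⊂ NS(X)` is the class of a
smooth rational curve, and (with `L·E₈(−2) = 0`, `L` ample) no nonzero class of `E₈(−2)` is effective. -/
theorem E8_neg2_no_root (v : Fin 8 → ℤ) :
    v ⬝ᵥ (((-2 : ℤ) • CartanMatrix.E₈) *ᵥ v) ≠ -2 := by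
  intro h
  have h4 := E8_neg2_norm_dvd_four v
  rw [h] at h4
  omega

/-- **K1-integrality core.** For pairwise orthogonal `(−4)`-vectors `r, s` the half-sum `½(r+s)` has
norm `−2`; by `E8_neg2_no_root` it is not in `E₈(−2)`, so `Ψ = g^* ⊕ (N_j ↦ r_j)` is not integral on the
Nikulin glue `½(N_i+N_j) + ½m_{ij}`: `Ψ` is rational with `2Ψ` integral. -/
theorem half_sum_norm {M : Type*} [AddCommGroup M] [Module ℚ M] (B : LinearMap.BilinForm ℚ M)
    (r s : M) (hr : B r r = -4) (hs : B s s = -4) (hrs : B r s = 0) (hsr : B s r = 0) :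
    B ((1 / 2 : ℚ) • (r + s)) ((1 / 2 : ℚ) • (r + s)) = -2 := by
  simp only [map_add, map_smul, LinearMap.add_apply, LinearMap.smul_apply, smul_eq_mul, hr, hs, hrs,
    hsr]
  norm_num

/-- **`m` is even.** If `graph Ψ ∉ H⁴(X×Y′,ℤ)` but `2·graph Ψ` is integral, then an integral class
`m·graph Ψ` (the mixed Künneth component of `c₂(G)`, integral because the pure components `n_X[pt]⊗1`,
`1⊗n_Y[pt]` are) forces `2 ∣ m`.  Abstract form over any lattice `Λ` in a group `V`. -/
theorem m_even_of_halfIntegral {V : Type*} [AddCommGroup V] (Λ : AddSubgroup V) (g : V)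
    (h2 : (2 : ℤ) • g ∈ Λ) (hg : g ∉ Λ) (m : ℤ) (hm : m • g ∈ Λ) : Even m := by
  by_contra hodd
  rw [Int.not_even_iff_odd] at hodd
  obtain ⟨k, hk⟩ := hodd
  apply hg
  have key : g = m • g - k • ((2 : ℤ) • g) := by
    rw [hk, smul_smul, ← sub_smul]
    have : (2 * k + 1 - k * 2 : ℤ) = 1 := by ring
    rw [this, one_smul]
  rw [key]
  exact Λ.sub_mem hm (Λ.zsmul_mem h2 k)

end LatticeParity

/-! ## §B  No 2-similitude in odd rank [inherited]; homothety degree [new form] -/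

section Parity

/-- No rational square equals `2^n` for `n` odd (2-adic valuation). -/
theorem no_rat_sq_eq_two_pow_odd {n : ℕ} (hn : Odd n) (q : ℚ) : q ^ 2 ≠ (2 : ℚ) ^ n := by
  intro h
  have hq : q ≠ 0 := by
    rintro rfl
    have : (2 : ℚ) ^ n ≠ 0 := pow_ne_zero _ two_ne_zero
    exact this (by simpa using h.symm)
  haveI : Fact (Nat.Prime 2) := ⟨Nat.prime_two⟩
  have h1 : padicValRat 2 (q ^ 2) = padicValRat 2 ((2 : ℚ) ^ n) := by rw [h]
  rw [padicValRat.pow, padicValRat.pow] at h1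
  have h2 : padicValRat 2 (2 : ℚ) = 1 := by
    have := padicValRat.self (p := 2) one_lt_two
    simpa using this
  rw [h2] at h1
  obtain ⟨k, hk⟩ := hn
  subst hk
  push_cast at h1
  omega

/-- **§B core [inherited].** A nondegenerate quadratic space of ODD rank over `ℚ` admits no similitude of
multiplier `2` (`det` picks up `2^n`, `n` odd).  With `rk T(X) = 13` on the generic Nikulin member:
`T(Y′)_ℚ ≅ T(X)_ℚ(2)` is never isometric to `T(X)_ℚ`, so a carrier whose generic slice is stable with
ISOTROPIC Mukai vector (2-dimensional fine moduli `M ≅` FM-partner, `T(M) ≅ T(X)`) cannot exist. -/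
theorem no_two_similitude_of_odd_rank {n : ℕ} (hn : Odd n) (D L : Matrix (Fin n) (Fin n) ℚ)
    (hD : D.det ≠ 0) : Lᵀ * D * L ≠ (2 : ℚ) • D := by
  intro h
  have hdet := congrArg Matrix.det h
  rw [Matrix.det_mul, Matrix.det_mul, Matrix.det_transpose, Matrix.det_smul, Fintype.card_fin] at hdet
  have hsq : L.det ^ 2 = (2 : ℚ) ^ n := by
    have : (L.det ^ 2 - (2 : ℚ) ^ n) * D.det = 0 := by rw [sub_mul]; linear_combination hdet
    rcases mul_eq_zero.mp this with h0 | h0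
    · linear_combination h0
    · exact absurd h0 hD
  exact no_rat_sq_eq_two_pow_odd hn _ hsq

/-- **§B′ [new form of gen-1 E3(ii)].** A tri-holomorphic map `f : Y′ → M` between compact hyperkähler
surfaces is a homothety (`df` is `ℍ`-linear, the conformal factor is constant because `f^*ω_I` is closed
and `∧ω_I : Λ¹ → Λ³` is injective), hence a Riemannian covering, hence of degree `|π₁(M)| = 1` onto a K3;
but `c₂(G)^{(2,2)} = m·graphΨ` makes `f^* ∘ θ = 2mΨ⁻¹` a similitude of multiplier `2m²` on `T(X)`, i.e.
`deg f = 2m²`.  `2m² = 1` has no integer solution. -/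
theorem two_mul_sq_ne_one (m : ℤ) : 2 * m ^ 2 ≠ 1 := by
  intro h
  have : Even (2 * m ^ 2) := even_two_mul _
  rw [h] at this
  exact Int.not_even_one this

end Parity

/-! ## §C  Sign law `m > 0` [inherited statement, new pointwise proof] -/

section SignLaw

variable {ι κ : Type*} [Fintype ι] [Fintype κ]

/-- **Mixed-block energy identity.**  `I` (resp. `I′`) is the matrix of the complex structure of `T_xX`
(resp. `T_yY′`) in an orthonormal frame (`I² = −1`; orthogonality is not even needed), `B` a
`𝔲(r)`-component of the MIXED curvature block `Θ_m ∈ T^*X ⊗ T^*Y′` of a connection of type `(1,1)`: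
invariance under the diagonal circle `(e^{tI}, e^{tI′})` reads `B I′ = I B`.  The density of
`tr(Θ_m ∧ Θ_m) ∧ ω_X ∧ ω_{Y′}` is `−tr(I B I′ Bᵀ)` per component, and this equals `‖B‖²`. -/
theorem mixedBlock_energy [DecidableEq ι] (I : Matrix ι ι ℝ) (I' : Matrix κ κ ℝ)
    (B : Matrix ι κ ℝ) (hI : I * I = -1) (hB : B * I' = I * B) :
    -Matrix.trace (I * B * I' * Bᵀ) = Matrix.trace (B * Bᵀ) := by
  have key : I * B * I' * Bᵀ = -(B * Bᵀ) := by
    rw [Matrix.mul_assoc I B I', hB, ← Matrix.mul_assoc I I B, hI]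
    simp
  rw [key, Matrix.trace_neg, neg_neg]

/-- `tr(B Bᵀ) = Σ B_{ij}²`. -/
theorem trace_mul_transpose_self_eq_sum (B : Matrix ι κ ℝ) :
    Matrix.trace (B * Bᵀ) = ∑ i, ∑ j, B i j ^ 2 := by
  simp [Matrix.trace, Matrix.mul_apply, sq]

/-- `tr(B Bᵀ) ≥ 0`: with `mixedBlock_energy` and anti-self-duality of the pure blocks
(`Θ_XX ∧ ω_X = 0 = Θ_YY ∧ ω_{Y′}`, from `SU(2)_X`-, `SU(2)_{Y′}`-invariance of the pure blocks of an
`SU(2)_Δ`-invariant form) this gives `m·ω² = ∫ c₂(G) ∧ ω ⊗ ω′ = (8π²)⁻¹ ‖Θ_mixed‖² ≥ 0`. -/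
theorem trace_mul_transpose_self_nonneg (B : Matrix ι κ ℝ) : 0 ≤ Matrix.trace (B * Bᵀ) := by
  rw [trace_mul_transpose_self_eq_sum]
  exact Finset.sum_nonneg fun i _ => Finset.sum_nonneg fun j _ => sq_nonneg _

/-- … with equality iff the mixed block vanishes (`m = 0` iff the hyperholomorphic connection is locally a
product, in which case `c₂^{(2,2)} = 0`): so `m > 0` for every genuine carrier. -/
theorem trace_mul_transpose_self_eq_zero_iff (B : Matrix ι κ ℝ) :
    Matrix.trace (B * Bᵀ) = 0 ↔ B = 0 := by
  rw [trace_mul_transpose_self_eq_sum]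
  constructor
  · intro h
    ext i j
    have hi := (Finset.sum_eq_zero_iff_of_nonneg (fun i _ =>
      Finset.sum_nonneg fun j _ => sq_nonneg (B i j))).mp h i (Finset.mem_univ _)
    have hij := (Finset.sum_eq_zero_iff_of_nonneg (fun j _ => sq_nonneg (B i j))).mp hi j
      (Finset.mem_univ _)
    simpa using hij
  · rintro rfl
    simp

/-- The cohomological side of the sign law: `∫ κ ∪ (ω ⊗ ω′) = (Kω′·ω)` for `κ = graph K`; with
`K = mΨ`, `Ψω′ = ω`, `ω² = 2ω′²` this is `m·ω² = 2m·ω′²`, so `sign m = sign ∫ c₂ ∧ ω ⊗ ω′`. -/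
theorem signLaw_bookkeeping (m ω2 ω'2 E : ℝ) (hω : ω2 = 2 * ω'2) (hpos : 0 < ω'2)
    (hE : m * ω2 = E) (hEnn : 0 ≤ E) : 0 ≤ m := by
  subst hω
  nlinarith

end SignLaw

/-! ## §D  Generic frame [new] -/

section GenericFrame

/-- **Generic frame kills invariant divisors.**  Write `ω = λL_h − Σ_k ε_k r_k`; for
`v = αL_h + Σ_k β_k r_k ∈ NS(X)_ℚ` one has `v·ω = α(λL_h²) + Σ_k β_k(4ε_k)`.  If the nine reals
`c = (λL_h², 4ε₁, …, 4ε₈)` are `ℚ`-linearly independent, `v·ω = 0` forces `v = 0`; likewise on `Y′` with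
`(h², 2ε₁, …, 2ε₈)`.  Consequences: `c₁(G) = 0`; `c₃(G) = 0 ∈ H⁶(X×Y′,ℚ)` (its Künneth components are
invariant rational classes in `NS(X)∩ω^⊥ ⊗ [pt]`, `[pt] ⊗ NS(Y′)∩ω′^⊥`); every stable summand of a
hyperholomorphic slice has `c₁ = 0`; the rational `SU(2)`-invariant mixed classes are `ℚ·graphΨ`
(Schur on `P ⊗ P′`, irreducibility of `T(Y′)_ℚ`, and this lemma for the `P^⊥ ⊗ P′^⊥` part). -/
theorem generic_frame_no_invariant_divisor {n : ℕ} (c : Fin n → ℝ) (hli : LinearIndependent ℚ c)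
    (q : Fin n → ℚ) (h : ∑ i, (q i : ℝ) * c i = 0) : q = 0 := by
  have h' : ∑ i, q i • c i = 0 := by
    simpa [Rat.smul_def] using h
  funext i
  exact Fintype.linearIndependent_iff.mp hli q h' i

end GenericFrame

/-! ## §E  Admissible slice Mukai vectors [inherited bound, new enumeration] -/

section Slices

/-- **Slice bound [gen-1 §F].** For a `c₁ = 0` sheaf on a K3 with Mukai vector `(r, 0, s)`:
`χ = r + s`, `c₂ = r − s`; on the generic twistor fibre (no curves) a stable bundle `≠ 𝒪` has
`h⁰ = h² = 0`, so `χ = −h¹ ≤ 0`. -/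
theorem slice_chi_nonpos (h0 h1 h2 : ℕ) (r s : ℤ) (hchi : (h0 : ℤ) - h1 + h2 = r + s)
    (hh0 : h0 = 0) (hh2 : h2 = 0) : s ≤ -r := by
  subst hh0; subst hh2; omega

/-- Admissible slice vectors `v = (r, 0, s)`: rank `≥ 2` (a rank-1 reflexive slice with `c₁ = 0` is `𝒪`)
and `χ = r + s ≤ 0`. -/
def AdmissibleSlice (r s : ℤ) : Prop := 2 ≤ r ∧ s ≤ -r

instance (r s : ℤ) : Decidable (AdmissibleSlice r s) := by
  unfold AdmissibleSlice; infer_instance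

/-- `c₂ = r − s ≥ 2r` (gen-1 `slice_c2_ge_twice_rank`). -/
theorem AdmissibleSlice.c2_ge {r s : ℤ} (h : AdmissibleSlice r s) : 2 * r ≤ r - s := by
  unfold AdmissibleSlice at h; omega

/-- `v² = −2rs ≥ 2r² ≥ 8`: the slice moduli spaces `M_X(v)` have dimension `v² + 2 ≥ 10`. -/
theorem AdmissibleSlice.vsq_ge {r s : ℤ} (h : AdmissibleSlice r s) :
    2 * r ^ 2 ≤ -2 * r * s ∧ 8 ≤ -2 * r * s := by
  obtain ⟨hr, hs⟩ := h
  constructor <;> nlinarith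

/-- The minimal case is O'Grady's imprimitive `(2, 0, −2)` (`v² = 8`, `c₂ = 4`, `χ = 0`); all admissible
`(r, s)` with `v² ≤ 30`. In particular the K2 cards' test vectors `(2,0,−1)` (`χ = 1`) and every `v`
with `v² ∈ {2, 4, 6}` (fourfolds, sixfolds, eightfolds) are NOT admissible. -/
theorem AdmissibleSlice.small_cases {r s : ℤ} (h : AdmissibleSlice r s) (hv : -2 * r * s ≤ 30) :
    (r, s) ∈ ({(2, -2), (2, -3), (2, -4), (2, -5), (2, -6), (2, -7), (3, -3), (3, -4), (3, -5)} :
      Finset (ℤ × ℤ)) := by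
  obtain ⟨hr, hs⟩ := h
  have hr3 : r ≤ 3 := by nlinarith
  have hs7 : -7 ≤ s := by nlinarith
  interval_cases r <;> interval_cases s <;> simp_all

theorem not_admissible_2_neg1 : ¬ AdmissibleSlice 2 (-1) := by decide

/-- Primitive admissible vectors have `v² ≥ 12` (smallest: `(2, 0, −3)`, `dim M = 14`, `K3^{[7]}`-type). -/
theorem AdmissibleSlice.primitive_vsq_ge_twelve {r s : ℤ} (h : AdmissibleSlice r s)
    (hg : Int.gcd r s = 1) : 12 ≤ -2 * r * s := by
  obtain ⟨hr, hs⟩ := h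
  by_cases hr2 : r = 2
  · subst hr2
    by_cases hs2 : s = -2
    · subst hs2; simp at hg
    · omega
  · have hr3 : 3 ≤ r := by omega
    nlinarith [mul_nonneg (by linarith : (0:ℤ) ≤ 2 * r) (by linarith : (0:ℤ) ≤ -(s + r))]

/-- Not bimeromorphic to a Hilbert scheme at Picard rank 0: `M_{X_t}(r,0,s) ~ X_t^{[n]}` (`n − 1 = −rs`)
would need a Hodge isometry of `H̃(X_t) = H²(X_t) ⊕ U` moving `(r, s) ∈ U` to `(1, 1 − n)`; `O(U)` only
permutes/negates coordinates, so `{r, −s} = {1, n − 1}`, impossible for admissible slices. (This is why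
Verbitsky's GAFA-1998 emptiness theorem does not transfer — gen-1 §G fairness, made arithmetic.) -/
theorem AdmissibleSlice.not_hilbert_type {r s : ℤ} (h : AdmissibleSlice r s) :
    ¬ (r = 1 ∨ -s = 1) := by
  obtain ⟨hr, hs⟩ := h; omega

end Slices

/-! ## §F  Jump theorem along `X × N_j` [new] -/

section Jump

variable {V W : Type*} [AddCommGroup V] [Module ℚ V] [AddCommGroup W] [Module ℚ W]

/-- **Slant identity.** If `(d_i)` is dual to the basis `(b_i)` under the cup form `B` of `H²(Y′)`,
the correspondence `κ = Σ_i K(b_i) ⊗ d_i` restricted to `X × N` and pushed to `X` gives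
`Σ_i B(d_i, N)·K(b_i) = K(N)`: the GRR jump class of the family `x ↦ G|_{{x}×N_j}` is
`π_* c₂(G|_{X×N_j}) = K(N_j) = m·Ψ(N_j) = m·r_j` (the pure components of `c₂` restrict/push to `0`). -/
theorem slant_restrict {n : ℕ} (B : LinearMap.BilinForm ℚ V) (b d : Fin n → V)
    (hdual : ∀ i j, B (d i) (b j) = if i = j then 1 else 0) (K : V →ₗ[ℚ] W) (c : Fin n → ℚ) :
    ∑ i, B (d i) (∑ j, c j • b j) • K (b i) = K (∑ j, c j • b j) := by
  simp [map_sum, map_smul, hdual, Finset.sum_ite_eq, Finset.mem_univ]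

/-- **Jump-class dichotomy.** `Eff` = classes of effective divisors, `deg` = degree against the ample
ι-invariant class `L`; nonzero effective classes have positive degree, `r_j·L = 0`.  Then `m·r_j`
(`m ≠ 0`) is a NONZERO non-effective class: the jump locus `{x : G^x|_{N_j} ≇ 𝒪^r}`, being either all of
`X` or a divisor of class `m·r_j` (empty would force `m·r_j = 0`), is all of `X`. -/
theorem jump_class_not_effective {Λ : Type*} [AddCommGroup Λ] [NoZeroSMulDivisors ℤ Λ]
    (Eff : Λ → Prop) (deg : Λ →+ ℤ) (hEff : ∀ D, Eff D → D ≠ 0 → 0 < deg D)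
    (r : Λ) (hr : deg r = 0) (hr0 : r ≠ 0) (m : ℤ) (hm : m ≠ 0) :
    m • r ≠ 0 ∧ ¬ Eff (m • r) := by
  have hne : m • r ≠ 0 := smul_ne_zero hm hr0
  refine ⟨hne, fun hE => ?_⟩
  have := hEff _ hE hne
  rw [map_zsmul, hr, smul_zero] at this
  exact lt_irrefl _ this

/-- `r_j · ω = 4ε_j` for `ω = L′ − Σ_k ε_k r_k`, `r_j ⊥ L′`, `r_j·r_k = −4δ_{jk}`. -/
theorem rdot_omega {M : Type*} [AddCommGroup M] [Module ℝ M] (B : LinearMap.BilinForm ℝ M)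
    (L : M) (r : Fin 8 → M) (ε : Fin 8 → ℝ) (j : Fin 8)
    (hrr : ∀ k, B (r j) (r k) = if j = k then -4 else 0) (hrL : B (r j) L = 0) :
    B (r j) (L - ∑ k, ε k • r k) = 4 * ε j := by
  simp [map_sub, map_sum, map_smul, hrr, hrL, Finset.sum_ite_eq, Finset.mem_univ]
  ring

/-- `N_j · ω′ = 2ε_j` for `ω′ = h − Σ_k ε_k N_k`, `N_j ⊥ h`, `N_j·N_k = −2δ_{jk}`. -/
theorem Ndot_omega' {M : Type*} [AddCommGroup M] [Module ℝ M] (B : LinearMap.BilinForm ℝ M)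
    (h : M) (N : Fin 8 → M) (ε : Fin 8 → ℝ) (j : Fin 8)
    (hNN : ∀ k, B (N j) (N k) = if j = k then -2 else 0) (hNh : B (N j) h = 0) :
    B (N j) (h - ∑ k, ε k • N k) = 2 * ε j := by
  simp [map_sub, map_sum, map_smul, hNN, hNh, Finset.sum_ite_eq, Finset.mem_univ]
  ring

/-- **Sub-line-bundle slope (★).**  Rank 2: the relative Harder–Narasimhan line `A ⊠ 𝒪(d)` (`d ≥ 1`) of
`G|_{X×N_j}` satisfies `2d·c₁(A) = D_W − m·r_j` (`D_W = π_*[W] ≥ 0` effective); pairing with `ω`: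
`2d·(A·ω) = D_W·ω − 4mε_j`.  Polystability of the hyperholomorphic slice `G^p ⊃ A` (`p ∈ N_j` generic)
gives `A·ω ≤ 0`, hence `D_W·ω ≤ 4mε_j`. -/
theorem subline_slope (d m ε dWω aω : ℝ) (hd : 0 < d) (hrel : 2 * d * aω = dWω - 4 * m * ε)
    (hpoly : aω ≤ 0) : dWω ≤ 4 * m * ε := by nlinarith

/-- … and equality `A·ω = 0` would make `A` a degree-0 subsheaf of a slope-0 polystable bundle, hence
`A ⊂ 𝒪` saturating to an invariant summand, `A = 𝒪`, `D_W = m·r_j` effective — excluded by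
`jump_class_not_effective`.  So STRICTLY `D_W·ω < 4mε_j`. -/
theorem subline_slope_strict (d m ε dWω aω : ℝ) (hd : 0 < d) (hrel : 2 * d * aω = dWω - 4 * m * ε)
    (hpoly : aω < 0) : dWω < 4 * m * ε := by nlinarith

/-- **Squeeze as `ε_j → 0`.** A nonzero effective `D_W` has `D_W·ω ≥ c > 0` with `c` bounded below on
compact subsets of the frame cone (e.g. `c = λ(L_h·D_W) − O(ε) ≥ λ/2`); so a carrier with `D_W ≠ 0`
needs `ε_j > c/(4m)`.  For `ε_j` below that, `D_W = 0`, `2d ∣ m` and `A = 𝒪_X(−(m/2d)·r_j)`. -/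
theorem eps_lower_bound (c m ε dWω : ℝ) (hm : 0 < m) (hc : c ≤ dWω) (hlt : dWω < 4 * m * ε) :
    c / (4 * m) < ε := by
  rw [div_lt_iff₀ (by positivity)]
  nlinarith

/-- When `D_W = 0`: `2d·c₁(A) = −m·r_j` with `r_j` primitive forces `2d ∣ m` (abstract: in a lattice with
`r` primitive, `n·a = m·r` implies `n ∣ m`).  Primitivity is encoded as: every `x` with `k·x ∈ ℤr`,
`k ≠ 0`, lies in `ℤr`. -/
theorem twod_dvd_m {Λ : Type*} [AddCommGroup Λ] [NoZeroSMulDivisors ℤ Λ] (r a : Λ) (hr0 : r ≠ 0)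
    (hprim : ∀ (x : Λ) (k : ℤ), k ≠ 0 → (∃ t : ℤ, k • x = t • r) → ∃ t : ℤ, x = t • r)
    (n m : ℤ) (hn : n ≠ 0) (h : n • a = m • r) : n ∣ m := by
  obtain ⟨t, ht⟩ := hprim a n hn ⟨m, h⟩
  refine ⟨t, ?_⟩
  rw [ht, smul_smul] at h
  have : (n * t - m) • r = 0 := by rw [sub_smul, h, sub_self]
  rcases smul_eq_zero.mp this with h0 | h0
  · linarith
  · exact absurd h0 hr0

end Jump

/-! ## §G  Rational curves `R_j = f(N_j)` in the slice moduli space [new] -/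

section Curves

/-- Degrees of `θ`-classes on `R_j`: `θ(x)·R_j = (f^*θ(x))·N_j = 2m·(Ψ⁻¹x · N_j)`.  For `x = r_k`
(`Ψ⁻¹r_k = N_k`): `−4m·δ_{jk}`; the dual class of `R_j` in `NS(M_X(v))_ℚ = θ(NS(X)_ℚ) ⊕ ℚθ(u)` is
therefore `m·θ(r_j)` (pairings with `θ(L_h)` and `θ(u)` vanish), of square `−4m² < 0`. -/
theorem Rj_degree_rk (m : ℝ) (NN : Fin 8 → Fin 8 → ℝ) (j k : Fin 8)
    (hNN : NN j k = if j = k then -2 else 0) :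
    2 * m * NN j k = if j = k then -4 * m else 0 := by
  rw [hNN]; split_ifs <;> ring

/-- `θ(ω)·R_j = 2m·(ω′·N_j) = 4mε_j → 0`: every ample class `aθ(L) + Σ_k b_kθ(r_k) + cθ(u)` of `M_ω(v)`
has `b_j < 0` for all `j` (since `(…)·R_j = −4m·b_j > 0`), consistent with `θ(ω_ε)` (`b_j = −ε_j`); the
`R_j` are contracted at the walls `r_j^⊥` (`ε_j = 0`). -/
theorem Rj_degree_omega (m ε Nω' : ℝ) (hN : Nω' = 2 * ε) : 2 * m * Nω' = 4 * m * ε := by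
  subst hN; ring

theorem ample_coefficient_sign (m b : ℝ) (hm : 0 < m) (hpos : 0 < -4 * m * b) : b < 0 := by
  nlinarith

end Curves

/-! ## §H  Integrality and Riemann–Roch bookkeeping [new] -/

section Integrality

variable {n : Type*} [Fintype n] [DecidableEq n]

/-- `Σ_{ij} A_{ij} (A⁻¹)_{ij} = rank` for an invertible symmetric Gram matrix: with `κ = m·graphΨ`,
`∫_{X×Y′} κ ∪ κ = m²·Σ_{ij}(Ψe_i·Ψe_j)(e^i·e^j) = 2m²·Σ_{ij}A_{ij}A⁻¹_{ij} = 44m²` (`b₂ = 22`). -/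
theorem sum_mul_inv_entries (A : Matrix n n ℚ) (hA : A.IsSymm) (hdet : IsUnit A.det) :
    ∑ i, ∑ j, A i j * A⁻¹ i j = Fintype.card n := by
  have h1 : ∑ i, ∑ j, A i j * A⁻¹ i j = Matrix.trace (A * (A⁻¹)ᵀ) := by
    simp [Matrix.trace, Matrix.mul_apply]
  rw [h1, Matrix.transpose_nonsing_inv, hA.eq, Matrix.mul_nonsing_inv _ hdet, Matrix.trace_one]

/-- `χ(G)` on `X × Y′` by HRR (`td = (1 + 2[pt])⊠(1 + 2[pt])`, `c₁ = c₃ = 0`):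
`χ = ch₄ − 2n_X − 2n_Y + 4r`, `ch₄ = (c₂² − 2c₄)/12`, `∫c₂² = 2n_Xn_Y + 44m²`. -/
def chiCarrier (r nX nY m c4 : ℤ) : ℚ :=
  (2 * nX * nY + 44 * m ^ 2 - 2 * c4) / 12 - 2 * (nX + nY) + 4 * r

/-- Integrality of `χ(G)` is the congruence `6 ∣ n_X n_Y + 22m² − c₄` — satisfiable, no kill. -/
theorem six_dvd_of_chiCarrier_integral (r nX nY m c4 z : ℤ) (h : chiCarrier r nX nY m c4 = z) :
    (6 : ℤ) ∣ nX * nY + 22 * m ^ 2 - c4 := by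
  have h12 : ((2 * (nX * nY + 22 * m ^ 2 - c4) - 24 * (nX + nY) + 48 * r : ℤ) : ℚ) =
      ((12 * z : ℤ) : ℚ) := by
    push_cast
    rw [← h]
    unfold chiCarrier
    ring
  have hint : 2 * (nX * nY + 22 * m ^ 2 - c4) - 24 * (nX + nY) + 48 * r = 12 * z := by
    exact_mod_cast h12
  exact ⟨z + 2 * (nX + nY) - 4 * r, by linarith⟩

/-- Discriminant positivity `∫ Δ(G) ∧ Ω² ≥ 0` for `Ω = ω ⊞ ω′`, `c₁ = 0`:
`∫ c₂ ∧ Ω² = n_X ω′² + n_Y ω² + 4m ω′² = ω′²(n_X + 2n_Y + 4m)` — with `n_X, n_Y ≥ 2r` (§E) this is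
implied by `m ≥ 0` and gives nothing new (gen-1 §C: positivity cannot kill K1). -/
theorem bogomolov_bookkeeping (nX nY m ω'2 : ℝ) (hω : 0 < ω'2) (hn : 0 ≤ nX) (hn' : 0 ≤ nY)
    (hm : 0 ≤ m) : 0 ≤ nX * ω'2 + nY * (2 * ω'2) + 2 * (m * (2 * ω'2)) := by positivity

end Integrality

/-! ## §K  Symplectic rigidity along the nodal curves [new]

**Setting.** `G` a carrier, `f : Y′ ∖ Σ → M := M_X(v)^{s,lf}` its classifying map (tri-holomorphic
homothety, `f^*g_M = c·g_{Y′}`, `c > 0`, so an immersion; `f^*σ_M = c·σ_{Y′}` where `σ_M` = the `L²`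
holomorphic symplectic form = Mukai's form `tr(ξ ∘ η)` — same cohomological pairing
`∫_X tr(a∧b)∧σ_X`).  Fix `j`; `V := G|_{X×N_j}` on `X × ℙ¹`; relative HN data along `π : X×ℙ¹ → X`:
top piece `S = π^*A ⊗ 𝒪(d₁) ↪ V` saturated, `A := (π_*V(−d₁))^{**}` of rank `a`, `1 ≤ a < r`, `d₁ ≥ 1`
(§F: the generic splitting type is unbalanced).  Restricting to `X × {p}`: the SAME sheaf `A ↪ G^p` for
every `p ∈ N_j` (injective for all `p`: `Tor₁(V/S, 𝒪_{X×p}) = 0` as `V/S` is torsion-free), quotient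
`Q_p := G^p / A`.

**Step 1 (extension families are isotropic).** For fixed sheaves `A, Q` on `X`, the family
`P_Q := {E_e : e ∈ ℙ(Ext¹(Q, A))}` has tangent vectors `ξ = i ∘ ξ′ ∘ π` (`ξ′ ∈ Ext¹(Q,A)`,
`0 → A →i E →π Q → 0`), and `ξ₁[1] ∘ ξ₂ = i[2] ξ′₁[1] (π i)[1] ξ′₂ π = 0` since `π ∘ i = 0`; so
`σ_M(ξ₁, ξ₂) = tr(0) = 0`: `P_Q` is isotropic.  `ℙ(Ext¹(Q,A)) → M` is an injective immersion when
`Hom(Q,E) = 0` and `Hom(A,E) = ℂ` (e.g. `h⁰(𝒪(−2c₁(A))) = 0`, automatic when `−2c₁(A) ∈ E₈(−2)_ℚ`).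
More generally the Brill–Noether locus `𝒫 = ⋃_Q P_Q` (quotients `Q` moving in their moduli) is
COISOTROPIC with the `P_Q` as characteristic leaves (`σ(ξ, η) = ⟨ξ′, πηi⟩_{Serre}` vanishes for `η`
tangent to `𝒫`), and any `P_Q`-bundle over a CURVE of quotients is again isotropic.

**Step 2 (symplectic surface vs isotropic submanifold).** If a `σ`-symplectic immersed surface `Z ∋ R`
contains an immersed rational curve `φ : ℙ¹ → R ⊂ P` with `P` isotropic and smooth along `R`, then for
`v = dφ(∂_t)`: `σ(v, ·)` kills `TP`, so `σ(v, n) = ⟨v, [n]⟩` with `[n] ∈ N_{P/M} ↠ T^*P`; nondegeneracy of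
`σ|_Z` along `R` gives a bundle map `N_{ℙ¹/Z} → φ^*T^*P` whose composite with `φ^*T^*P → T^*ℙ¹` is an
isomorphism, i.e. `Tℙ¹ = 𝒪(2)` is a DIRECT SUMMAND of `φ^*TP`.

**Step 3 (degree).** If `Q_p ≅ Q` is constant on `N_j` then `V ≅` an extension of `Q ⊠ 𝒪(d′)` by
`A ⊠ 𝒪(d₁)` (seesaw), `c₁(V) = 0` gives `a d₁ + (r−a) d′ = 0`, and `c₂(V)^{(2,2)} = α(d′ − d₁) ⊗ [pt]`
(`α = c₁(A)`), so `m·r_j = −α·r d₁/(r−a)` (`mixed_class_constQ`).  On `P_Q ≅ ℙ^φ` the universal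
extension `0 → A ⊠ 𝒪(1) → 𝓔 → Q ⊠ 𝒪 → 0` has `Δ(𝓔)^{mixed} = −α ⊗ H`, so `θ(x)|_{P_Q} = −(α·x)·H` and
`θ(x)·φ_*[N_j] = (f^*θ(x))·N_j = 2m(Ψ⁻¹x·N_j)`; with `x = r_j`: `e·(α·r_j) = 4m`, whence the
`𝒪(1)`-degree of `φ_j = f|_{N_j}` is `e = r d₁/(r−a) > d₁ ≥ 1`, so `e ≥ 2` (`leafDegree_gt`,
`leafDegree_ge_two`); `x = r_k, L_h` give nothing new (`(x·r_j) = 2(Ψ⁻¹x·N_j)` identically).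

**Step 4 (Euler).** `φ_j^*Tℙ^φ = 𝒪(e)^{φ+1}/𝒪`, so every line-bundle QUOTIENT has degree `≥ e`; a
retraction onto `TN_j = 𝒪(2)` needs `e ≤ 2` (`retraction_degree`), so `e = 2`: then `φ_j` is either a
smooth conic (`TN_j ⊂ TΠ|_{conic} = 𝒪(3)²`, `Hom(𝒪(3),𝒪(2)) = 0`: no retraction) or a double cover of
a line (ramified: not an immersion).  CONTRADICTION.  Hence:

**Theorem (rigidity).** If `f` is regular, immersive and slice-stable along `N_j` (no punctures on the
nodal curve), the quotient family `p ↦ Q_p = G^p/A` is NOT constant on `N_j` — in any rank.  In rank 2,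
`Q_p = 𝒪(−α) ⊗ I_{W_p}` and the zero-scheme `W_p` of `A → G^p` MOVES with `p`; either
(γ) it sweeps a curve, `D_W = π_*[W] ≠ 0`, and §F's strict squeeze `D_W·ω < 4mε_j` forces
`m > (λ − Σ_kε_k D_W·r_k)/(4ε_j)` (`charge_lower_bound`: NO SMALL-CHARGE CARRIERS near the orbifold
wall; `m → ∞` as `ε → 0`), or (β) `D_W = 0` and `W_p` rotates inside a punctual Hilbert scheme at
fixed support (`w = |W_p| ≥ 2`, so `n_X = 4c_j² + w ≥ 4c_j² + 2`; the case `W_p ≅ Hilb²_{x₀} ≅ ℙ¹`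
isomorphically passes Step 2's necessary test, higher covering degrees untested).

**Near-miss (punctures).** If `Σ ∩ N_j ≠ ∅` (a singular point of `G`, a non-stable slice, or an
indeterminacy point of `f` ON the nodal curve), `φ_j` still extends to `N_j → P̄_Q` but the normal
component of `df` is only meromorphic; Step 2 degrades to: its saturation `N′ ↪ φ^*Ω_{ℙ^φ}` has
`deg N′ = −2 − δ ≤ −e` and pairs with the saturated tangent `𝒪(2+z)` to an isomorphism off `Σ`, so
`δ ≥ max(e − 2, z)` with all `δ − z` zeros of the pairing at the punctures; for `δ = 0` the Euler-factor
computation `c(s(t)) ≡ 0 ⇒ c(ṡ) ≡ 0` kills it, for `δ ≥ 1` it is a genuine escape.  So a constant-`Q`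
carrier must put singular / unstable slices EXACTLY on the eight nodal curves.  This is where the
attack stands. -/

section Rigidity

/-- **Mixed class of a constant-quotient family.**  If `V = G|_{X×N_j}` is an extension
`0 → A ⊠ 𝒪(d₁) → V → Q ⊠ 𝒪(d′) → 0` (`rk A = a`, `rk Q = r − a`, `c₁(Q) = −c₁(A) =: −α`) with
`c₁(V) = 0`, i.e. `a·d₁ + (r−a)·d′ = 0`, then the mixed Künneth component of `c₂(V)` is
`α ⊗ [pt]·(d′ − d₁) = −α·(r·d₁/(r−a))`; equating with `m·r_j` gives `α = −(m(r−a)/(r d₁))·r_j`. -/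
theorem mixed_class_constQ (r a d₁ d' : ℚ) (hra : r - a ≠ 0) (hc1 : a * d₁ + (r - a) * d' = 0) :
    d' - d₁ = -(r * d₁ / (r - a)) := by
  field_simp
  linarith

/-- **Leaf degree.** The `𝒪(1)`-degree of `φ_j : N_j → P_Q = ℙ(Ext¹(Q,A))` is
`e = (θ(r_j)·R_j)/(θ(r_j)·ℓ) = (−4m)/(−(α·r_j)) = r·d₁/(r−a)`, and `r·d₁/(r−a) > d₁ ≥ 1` for
`0 < a < r`; so `e ≥ 2` — never a line. -/
theorem leafDegree_gt (r a d₁ : ℚ) (ha : 0 < a) (har : a < r) (hd : 1 ≤ d₁) :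
    d₁ < r * d₁ / (r - a) := by
  rw [lt_div_iff₀ (by linarith)]
  nlinarith

/-- An integer degree `e > d₁ ≥ 1` is at least `2`: the nodal curve never maps to a line of the leaf. -/
theorem leafDegree_ge_two (e : ℤ) (d₁ : ℤ) (hd : 1 ≤ d₁) (he : (d₁ : ℚ) < e) : 2 ≤ e := by
  have : (d₁ : ℚ) < (e : ℚ) := he
  have h' : d₁ < e := by exact_mod_cast this
  omega

/-- **Euler numerics.** `φ_j^*Tℙ^φ` is a quotient of `𝒪(e)^{φ+1}`, so each of its line-bundle quotients
has degree `≥ e`; a retraction onto `T N_j = 𝒪(2)` would be such a quotient, so `e ≤ 2`; with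
`leafDegree_ge_two`, `e = 2`, and the conic (`T ⊂ 𝒪(3)²`, `Hom(𝒪(3), 𝒪(2)) = 0`) and the double line
(ramified) are excluded geometrically.  The arithmetic shell: -/
theorem retraction_degree (e q : ℤ) (hquot : e ≤ q) (hq : q = 2) (he : 2 ≤ e) : e = 2 := by omega

/-- **Charge lower bound (escape γ of §K / squeeze of §F).**  If the zero-scheme sweeps a curve
`D_W ≠ 0` (`D_W·L_h ≥ 1`), then `λ(D_W·L_h) − Σ_kε_k(D_W·r_k) = D_W·ω < 4mε_j` gives
`m > (λ − S)/(4ε_j)` with `S := Σ_kε_k(D_W·r_k)` (bounded by `O(ε·√(2 + L_h²α²))` for an irreducible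
`D_W = αL_h + e`): small-charge carriers do not exist near the orbifold wall. -/
theorem charge_lower_bound (lam S ε m DL : ℝ) (hε : 0 < ε) (hl : 0 ≤ lam) (hDL : 1 ≤ DL)
    (hsq : lam * DL - S < 4 * m * ε) : (lam - S) / (4 * ε) < m := by
  rw [div_lt_iff₀ (by positivity)]
  have : lam ≤ lam * DL := by nlinarith
  nlinarith

end Rigidity

/-! ## §J  Why §F/§G reconcile gen-1 §K with the crux (prose)

At `ε = 0` the frame `(ω, ω′) = (λL_h, h)` is ι-invariant on `X` and orbifold on `Y′` (`h·N_j = 0`).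
There `ι^M` is tri-holomorphic on `M_X(v)` and its 2-dimensional fixed components are the McKay moduli
spaces `Y₁ = M_{Y′}(w)` of gen-1 §J; gen-1 §K showed their mixed class acts on `NS(Y₁)` through `η`
alone (kills the eight `(−2)`-classes) and that the matched class sits on a wall — i.e. these are
`[Γ]`-type carriers (`N_j ↦ 0`) living exactly at the boundary frame.  For `ε > 0` the crux asks for
`N_j ↦ m·r_j ≠ 0`; §F shows this forces, along every `X × N_j`, a Harder–Narasimhan piece
`𝒪_X(c₁(A)) ⊠ 𝒪(d)` with `2d·c₁(A) = D_W − m·r_j`, and §G shows the images `R_j = f(N_j)` are the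
extremal rational curves of the walls `r_j^⊥` which are crossed as `ε` leaves `0`.  So a carrier, if it
exists, is a wall-crossing transform of a McKay-type object acquiring `E₈`-twisted elementary pieces on
all eight `X × N_j` — the structure gen-1 (E1) proved absent from the Serre bundle `F`
(`Hom(F|_{X×N_j}, 𝒪(±r_j) ⊠ 𝒪(k)) = 0`).  Neither a construction nor an obstruction for such simultaneous
eightfold modifications is known; this is the precise residual question.
-/


/-! ## §L  [gen 3, FORMAL] The `∀ μ : OrientationFamily` quantifier kills every INTEGER-multiple clause

The certified content lives in the tree (proposed by this seat; see the module docstring for the landing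
paths): `Negative/OrientationTwist` (the witness family), `Negative/TypedCruxFalse`
(`typedNikulinSerreCarrier_twistFamily_false (C) : ¬ body[μ := twistFamily]`,
`typedNikulinSerreCarrier_false_of_nonempty_chernCharacterBetti : Nonempty ChernCharacterBetti → ¬ TypedCrux`,
`isEmpty_chernCharacterBetti_of_typedNikulinSerreCarrier : TypedCrux → IsEmpty ChernCharacterBetti`) and
`Negative/StubModularTwinAddressFalse` (the same three for `Statement.stub_modularTwinAddress`).  The statements
there are the VERBATIM bodies (inlined, because crux work-files are not importable and an untagged
`def … : Prop` under `Summits/` would be a vendored fact), so inside the skeleton file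
`example : (that statement) = NikulinSerreCarrier := rfl` identifies them.

Here only the two self-contained cores are re-certified, so that this work-file stays importable by nothing
and checkable alone:

* the twist arithmetic: with `twist d = I ^ (d / 2)` the ratio `twist (d + 2) / twist d` — the factor a
  codimension-two Gysin map `H^a(Y(ℂ)) → H^b(X(ℂ))`, `dim Y = dim X + 2`, picks up — is `I`
  (`twist_ratio_eq_I`);
* the conjugation argument in the abstract: on a `ℂ`-module with a conjugate-linear involution (`conjClass`
  on `H^k(–; ℂ)`), if `I • ρ = r • q` with `ρ`, `q` FIXED by the involution (rational classes are),
  `conj r = r ≠ 0`, then `q = 0` (`fixed_eq_zero_of_I_smul_eq_smul`).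

REPAIRED CLAUSE offered to the planner (C′, the witness misses it):
`∃ m : ℂ, m ≠ 0 ∧ ∀ y, complexGysin μ … (cupProduct … (snd^* y) (C.ch (X ⊗ Y) G 2)) = (-m) • Ψ y`
(and `(-(2 * m)) • y` with `m : ℂ` in the address equation; `∃ m' : ℂ` in `stub_mixedClassTransfer`).
Integrality of the true `m` (even, positive: §A, §C, §H) is a statement about the COMPLEX orientation and
the STANDARD Chern character, neither of which the hypothesis-structure idiom pins down.
-/

section OrientationTwistCores

/-- **Twist ratio.** `I ^ ((d + 2) / 2) · (I ^ (d / 2))⁻¹ = I`: the scalar by which a codimension-two Gysin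
morphism changes when every fundamental class `[X(ℂ)]` (`dim X = d`) is rescaled by `I ^ (d / 2)`.
[cite: FultonYoungTableaux1997, Appendix B §B.1 (5)] -/
theorem twist_ratio_eq_I (d : ℕ) :
    Complex.I ^ ((d + 2) / 2) * (Complex.I ^ (d / 2))⁻¹ = Complex.I := by
  rw [show (d + 2) / 2 = d / 2 + 1 by omega, pow_succ, mul_comm (Complex.I ^ (d / 2)), mul_assoc,
    mul_inv_cancel₀ (pow_ne_zero _ Complex.I_ne_zero), mul_one]

/-- **Conjugation core.** `V` a `ℂ`-module with a conjugate-linear additive involution `c` (complex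
conjugation of classes); if `c ρ = ρ`, `c q = q` (rational classes are real), `conj r = r`, `r ≠ 0` and
`I • ρ = r • q`, then `q = 0`. [cite: VoisinHodgeI2002, Cor. 6.12] -/
theorem fixed_eq_zero_of_I_smul_eq_smul {V : Type*} [AddCommGroup V] [Module ℂ V] (c : V → V)
    (hc : ∀ (a : ℂ) (v : V), c (a • v) = starRingEnd ℂ a • c v) {ρ q : V} (hρ : c ρ = ρ) (hq : c q = q)
    {r : ℂ} (hr : starRingEnd ℂ r = r) (hr0 : r ≠ 0) (h : Complex.I • ρ = r • q) : q = 0 := by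
  have h1 := congrArg c h
  rw [hc, hc, hρ, hq, Complex.conj_I, hr, ← h, neg_smul] at h1
  have h2 : Complex.I • ρ = 0 := by
    have h3 : (2 : ℂ) • (Complex.I • ρ) = 0 := by
      rw [two_smul]
      nth_rewrite 1 [← h1]
      exact neg_add_cancel _
    exact (smul_eq_zero.1 h3).resolve_left two_ne_zero
  rw [h2] at h
  exact (smul_eq_zero.1 h.symm).resolve_left hr0

end OrientationTwistCores

/-! ## §M  Wall chamber, Uhlenbeck constancy, ribbons (gen 4) -/

section WallChamber

/-- **No separating wall (★★).**  Walls of `(r, c₁, c₂) = (2, 0, n_X)` between `ω = λL_h − Σε_kr_k`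
and `L_h` are `η^⊥`, `η = aL_h + e` (`a ≥ 1`, `e ∈ E₈(−2)`, `η² = a²L_h² + e² ≥ −n_X`), with
`η·L_h = aL_h² > 0` but `η·ω = aλL_h² − S ≤ 0`, `S := (Σε_kr_k)·e`.  Cauchy–Schwarz in the negative
definite `E₈(−2)` gives `S² ≤ 4|ε|²·|e²|`, and `|e²| ≤ n_X + a²L_h²`.  If `4|ε|²(n_X + L_h²) < λ²(L_h²)²`
then `S < aλL_h²` for every `a ≥ 1`: no wall separates, `L_h` lies in the closure of the chamber of `ω`,
`θ(L_h)` is nef on `M_ω(2,0,s)` and every `ω`-stable sheaf is `μ_{L_h}`-semistable. -/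
theorem no_separating_wall (a L2 lam eps2 nX e2 S : ℝ) (ha : 1 ≤ a) (hL : 0 < L2)
    (hn : 0 ≤ nX) (hwall : -nX ≤ a ^ 2 * L2 + e2)
    (hCS : S ^ 2 ≤ 4 * eps2 * (-e2)) (heps : 0 ≤ eps2)
    (hsmall : 4 * eps2 * (nX + L2) < lam ^ 2 * L2 ^ 2) (hlam : 0 < lam) :
    S < a * lam * L2 := by
  have h1 : -e2 ≤ nX + a ^ 2 * L2 := by linarith
  have ha2 : 1 ≤ a ^ 2 := by nlinarith
  have h2 : nX + a ^ 2 * L2 ≤ a ^ 2 * (nX + L2) := by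
    nlinarith [mul_nonneg (sub_nonneg.2 ha2) hn]
  have h3 : S ^ 2 < (a * lam * L2) ^ 2 := by
    calc S ^ 2 ≤ 4 * eps2 * (-e2) := hCS
      _ ≤ 4 * eps2 * (a ^ 2 * (nX + L2)) := by nlinarith
      _ = a ^ 2 * (4 * eps2 * (nX + L2)) := by ring
      _ < a ^ 2 * (lam ^ 2 * L2 ^ 2) := by
          apply mul_lt_mul_of_pos_left hsmall; positivity
      _ = (a * lam * L2) ^ 2 := by ring
  have hpos : 0 < a * lam * L2 := by positivity
  nlinarith [sq_nonneg (S - a * lam * L2), sq_nonneg (S + a * lam * L2), abs_nonneg S]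

/-- **Uhlenbeck degree.**  The Donaldson determinant line bundle `λ(u₁(L_h))` of the family
`{G_p}_{p ∈ N_j}` has degree proportional to `∫_{X×N_j} c₂(G) ∪ π_X^*L_h = n_X·([pt]⊗1 · L_h⊗1) +
m·(r_j·L_h) = m·(r_j·L_h) = 0`; since `λ(u₁(L_h))` descends to an AMPLE bundle on the Uhlenbeck–Li space
`M^{μss}_{L_h}` (Huybrechts–Lehn Thm 8.2.8) and points of that space are the pairs `(gr^{μ}(E)^{**}, l_E)`
(Thm 8.2.11), when `L_h` is in the closure of the chamber of `ω` the graded object `gr_{L_h}(G_p)^{**}`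
and the singularity 0-cycle `l(G_p)` are CONSTANT along each nodal curve.  Arithmetic core: -/
theorem uhlenbeck_degree_zero (nX m rL ptL : ℝ) (hpt : ptL = 0) (hr : rL = 0) :
    nX * ptL + m * rL = 0 := by
  subst hpt; subst hr; ring

/-- **Ribbon lemma (case β, `w = 2`).**  `W ⊂ X × N_j` is the zero scheme of a section of the rank-2
bundle `V′ = G|_{X×N_j} ⊗ (𝒪(c_jr_j) ⊠ 𝒪(−d))`, l.c.i. of codimension 2; in case β with `w = 2` it is a
double structure (ribbon) on `C = {x₀} × ℙ¹` with `I_C/I_W ≅ 𝒪(e)`, `e` = degree of the rotation map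
`N_j → ℙ(T_{x₀}X)`.  Then `χ(𝒪_W) = χ(𝒪_C) + χ(𝒪(e)) = e + 2`, `deg ω_W = −2χ(𝒪_W)`,
`deg_W(𝓜) = 2·deg(𝓜|_C)` for every line bundle, while the Serre correspondence gives
`ω_W ≅ (ω_{X×ℙ¹} ⊗ det V′)|_W` of `C`-degree `−2d − 2`.  Hence `e = 2d`: the rotation is a cover of
degree exactly `2d ≥ 2` (the `e = 1` "isomorphic" escape recorded in §K is closed). -/
theorem ribbon_degree (e d chiW degW degC : ℤ) (hchi : chiW = e + 2) (hdual : degW = -2 * chiW)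
    (hmult : degW = 2 * degC) (hserre : degC = -2 * d - 2) : e = 2 * d := by omega

/-- **Isotropic-fibre test (case β, single moving ribbon) forces `d_j = 1`.**  Along `R_j = f(N_j)` the
`X`-slices lie in the Uhlenbeck fibre `P = ℙ(𝓔) → ℙ¹_u`, `𝓔 = 𝓔xt¹_π(B⊗𝓘_𝒲, A) ≅ 𝒪^{N} ⊕ 𝒪(−1)`
(`N = 8c² − 1 + s`, from `0 → H¹(A−B)⊗𝒪 → 𝓔 → 𝓔xt²_π(B⊗𝒪_𝒲, A) ≅ (π_*𝒪_𝒲)^∨ ≅ 𝒪 ⊕ 𝒪(−1) → 0`),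
which is ISOTROPIC (fibre of the birational symplectic contraction `M → M^{μss}_{L_h}`, Kaledin).  With
`u = π ∘ φ` of degree `2d` (ribbon lemma) and `φ^*𝒪_P(1)` of degree `2d` (`θ(r_j)|_P = (B·r_j)H = −4cH`,
`θ(r_j)·R_j = −4m = −8cd`), the relative Euler sequence pulls back to
`0 → 𝒪 → 𝒪(2d)^N ⊕ 𝒪 → φ^*T_{P/ℙ¹} → 0` where the tautological line projects ISOMORPHICALLY onto the
`𝒪`-summand (local freeness of `G_p` at `x₀` = the extension class generates the socle of `ω_{W_p}`), so
`φ^*T_{P/ℙ¹} ≅ 𝒪(2d)^N` and `φ^*TP ∈ Ext(𝒪(4d), 𝒪(2d)^N)`.  §K Step 2 (σ-nondegeneracy of `Z` along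
`R_j`) needs a retraction `φ^*TP → TN_j = 𝒪(2)`, nonzero on `𝒪(2d)^N` since `Hom(𝒪(4d), 𝒪(2)) = 0`;
`Hom(𝒪(2d), 𝒪(2)) ≠ 0` forces `2d ≤ 2`.  Degree shell: -/
theorem single_ribbon_forces_d_eq_one (d : ℤ) (hd : 1 ≤ d) (hret : 2 * d ≤ 2 ∨ 4 * d ≤ 2) :
    d = 1 := by omega

/-- … and then `c_j = m/(2d_j) = m/2`, so `n_X = 4c_j² + w_j = m² + 2 + s_j` (`s_j` = number of static
reduced lines accompanying the ribbon). -/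
theorem nX_single_ribbon (m c nX w s : ℤ) (hc : 2 * c = m) (hn : nX = 4 * c ^ 2 + w)
    (hw : w = 2 + s) : nX = m ^ 2 + 2 + s := by
  subst hc; subst hw; rw [hn]; ring

end WallChamber

/-! ## §M′  Totally geodesic twin and the Grothendieck–Riemann–Roch package (gen 4) -/

section Geodesy

variable {V N : Type*} [AddCommGroup V] [AddCommGroup N] [Module ℚ N]

/-- **Trianalytic ⇒ totally geodesic (pointwise core).**  `h` = second fundamental form of
`Z = f(Y′) ⊂ M` (symmetric, `ℤ`-bilinear, values in the normal space), complex-linear in the first slot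
for TWO anticommuting complex structures `I, J` of the hyperkähler triple (`h(Iv,w) = I′h(v,w)`,
`h(Jv,w) = J′h(v,w)` with `I′² = J′² = −1`, `I′J′ = −J′I′` on the normal space): then `h = 0`.  So the twin
`Z` is totally geodesic in `(M, g_{L²})`, `TM|_Z = TZ ⊕ N_Z` is a PARALLEL splitting, `N_Z` is
hyperholomorphic (polystable, `c₁ = 0`, holomorphic symplectic), and `c₂(f^*TM) = 24 + c₂(N_Z)`. -/
theorem second_fundamental_form_vanishes (h : V →+ V →+ N) (hsymm : ∀ v w, h v w = h w v)
    (I J : V → V) (I' J' : N →ₗ[ℚ] N) (hI' : ∀ n, I' (I' n) = -n) (hJ' : ∀ n, J' (J' n) = -n)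
    (hanti : ∀ n, I' (J' n) = -J' (I' n))
    (hI : ∀ v w, h (I v) w = I' (h v w)) (hJ : ∀ v w, h (J v) w = J' (h v w)) (v w : V) :
    h v w = 0 := by
  -- a complex structure `T` with `h(Tv,w) = T′h(v,w)`, `T′² = −1` gives `h(Tv,Tw) = −h(v,w)`
  have key : ∀ (T : V → V) (T' : N →ₗ[ℚ] N), (∀ n, T' (T' n) = -n) →
      (∀ v w, h (T v) w = T' (h v w)) → ∀ v w, h (T v) (T w) = -h v w := by
    intro T T' hT' hT v w
    rw [hT, hsymm v (T w), hT, hT', hsymm]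
  have hII := key I I' hI' hI
  have hJJ := key J J' hJ' hJ
  -- `K = I ∘ J`, `K′ = I′ ∘ J′` is again such a pair
  have hK : ∀ v w, h (I (J v)) w = (I' ∘ₗ J') (h v w) := by
    intro v w; rw [hI, hJ]; rfl
  have hK' : ∀ n, (I' ∘ₗ J') ((I' ∘ₗ J') n) = -n := by
    intro n
    simp only [LinearMap.coe_comp, Function.comp_apply]
    have h1 : J' (I' (J' n)) = -I' (J' (J' n)) := by
      have := hanti (J' n); rw [this]; simp
    rw [h1, hJ']
    simp [map_neg, hI']
  have hKK := key (fun v => I (J v)) (I' ∘ₗ J') hK' hK v w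
  -- but also h(IJv, IJw) = -h(Jv,Jw) = h(v,w)
  have hKK' : h (I (J v)) (I (J w)) = h v w := by rw [hII, hJJ, neg_neg]
  have h2 : (2 : ℚ) • h v w = 0 := by
    rw [two_smul]
    nth_rewrite 1 [← hKK']
    rw [hKK, neg_add_cancel]
  exact (smul_eq_zero.mp h2).resolve_left two_ne_zero

end Geodesy

/-! ## §M″  The Grothendieck–Riemann–Roch package of a carrier (gen 4) -/

section GRR

/-- `Γ_Y := c₂(f^*TM)`, `f^*TM = R¹π_*𝓔nd G` (`π : X × Y′ → Y′`; `R⁰ = R² = 𝒪` for simple slices),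
computed by GRR from `ch(𝓔nd G) = r² − 2r·c₂ + (c₂² + 2r·ch₄)`, `td_π = 1 + 2[pt_X]`,
`π_*κ² = 2m²Σ A_{ij}e^ie^j` (degree `44m²`), `π_*(pq) = [pt]`, `ch₄ = (c₂² − 2c₄)/12` (`c₁ = c₃ = 0`):
`Γ_Y = 44m² + 2n_Xn_Y + (r/6)(44m² + 2n_Xn_Y − 2c₄) − 4rn_Y`. -/
def gammaY (r nX nY m c4 : ℚ) : ℚ :=
  44 * m ^ 2 + 2 * nX * nY + r / 6 * (44 * m ^ 2 + 2 * nX * nY - 2 * c4) - 4 * r * nY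

/-- `χ(X×Y′, 𝓔nd G)` by HRR with `td(X×Y′) = (1 + 2p)(1 + 2q)`. -/
def chiEnd (r nX nY m c4 : ℚ) : ℚ :=
  4 * r ^ 2 - 4 * r * (nX + nY) + 44 * m ^ 2 + 2 * nX * nY + r / 3 * (22 * m ^ 2 + nX * nY - c4)

/-- **Consistency of the package**: `χ(𝓔nd G) = Γ_Y − 2v²` with `v² = 2r(n_X − r)` the dimension
datum of the slice moduli space (`dim M = v² + 2`).  Independently, Leray for `π` gives
`χ(𝓔nd G) = χ(𝒪) − χ(f^*TM) + χ(𝒪) = 4 − χ(TY′) − χ(N) = 24 − χ(N)` and `χ(N) = 2·rk N − c₂(N)`,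
`rk N = v²`; with `Γ_Y = 24 + c₂(N)` (totally geodesic splitting) the two agree — `leray_consistency`. -/
theorem chiEnd_eq_gammaY_sub (r nX nY m c4 : ℚ) :
    chiEnd r nX nY m c4 = gammaY r nX nY m c4 - 2 * (2 * r * (nX - r)) := by
  unfold chiEnd gammaY; ring

theorem leray_consistency (Γ c2N v2 chiN chiE : ℚ) (hΓ : Γ = 24 + c2N) (hχN : chiN = 2 * v2 - c2N)
    (hE : chiE = Γ - 2 * v2) : chiE = 24 - chiN := by
  subst hΓ; subst hχN; subst hE; ring

/-- **Rank 2** (`c₃ = c₄ = 0` automatically): `c₂(N_Z) = Γ_Y − 24 = (176m² + 8n_Xn_Y)/3 − 8n_Y − 24`,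
the second Chern class of the normal bundle of the twin `Z ≅ Y′` in `M_X(2,0,2−n_X)`. -/
theorem gammaY_rank_two (nX nY m : ℚ) :
    gammaY 2 nX nY m 0 = (176 * m ^ 2 + 8 * nX * nY) / 3 - 8 * nY := by
  unfold gammaY; ring

/-- … which is `≥ 24` (indeed `> 234`) for every admissible datum (`n_X ≥ 4`, `m ≥ 2`, `n_Y ≥ 0`): the
positivity `c₂(N_Z) ≥ 0` of the polystable degree-0 normal bundle is never violated — no kill from
Gauss–Bonnet alone, recorded as the reason the geodesy package only CONSTRAINS. -/
theorem gammaY_rank_two_gt (nX nY m : ℚ) (hX : 4 ≤ nX) (hY : 0 ≤ nY) (hm : 2 ≤ m) :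
    234 < gammaY 2 nX nY m 0 := by
  rw [gammaY_rank_two]
  have h1 : (8 / 3 : ℚ) * nY ≤ 8 * nX * nY / 3 - 8 * nY := by nlinarith
  nlinarith

/-- **Integrality (rank 2).** `χ(G) = 8 − 2(n_X + n_Y) + (22m² + n_Xn_Y)/6 ∈ ℤ` iff
`6 ∣ 22m² + n_Xn_Y`; equivalently `3 ∣ 176m² + 8n_Xn_Y` (integrality of `Γ_Y`) plus parity.  With
`m = 2`: `n_Xn_Y ≡ 2 (mod 6)` — so the smallest charges die: -/
theorem census_m_two (p : ℤ) (h : (6 : ℤ) ∣ 22 * 2 ^ 2 + p) : p % 6 = 2 := by omega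

/-- `(m, n_X) = (2, 6)` (the minimal case-β charge `n_X = 4c² + 2`, `c = 1`) is impossible for every
`n_Y`; likewise `(2, 4)`, `(2, 5)` need `n_Y ≡ 2, 4 (mod 6)` resp. … (small-model census). -/
theorem census_m_two_nX_six (nY : ℤ) : ¬ (6 : ℤ) ∣ 22 * 2 ^ 2 + 6 * nY := by omega

/-- **Single moving ribbon with no static lines** (`n_X = m² + 2`): `6 ∣ 22m² + (m² + 2)n_Y` forces
`3 ∣ m` (so `6 ∣ m`) and `3 ∣ n_Y` — the smallest such carrier has `m = 6`, `n_X = 38`. -/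
theorem single_ribbon_congruence (m nY : ℤ) (h : (6 : ℤ) ∣ 22 * m ^ 2 + (m ^ 2 + 2) * nY) :
    (3 : ℤ) ∣ m ∧ (3 : ℤ) ∣ nY := by
  have h3 : (3 : ℤ) ∣ 22 * m ^ 2 + (m ^ 2 + 2) * nY := dvd_trans ⟨2, by norm_num⟩ h
  have hz : ((22 * m ^ 2 + (m ^ 2 + 2) * nY : ℤ) : ZMod 3) = 0 :=
    (ZMod.intCast_zmod_eq_zero_iff_dvd _ 3).2 h3
  push_cast at hz
  have key : ∀ a b : ZMod 3, 22 * a ^ 2 + (a ^ 2 + 2) * b = 0 → a = 0 ∧ b = 0 := by decide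
  obtain ⟨ha, hb⟩ := key _ _ hz
  exact ⟨(ZMod.intCast_zmod_eq_zero_iff_dvd m 3).1 ha, (ZMod.intCast_zmod_eq_zero_iff_dvd nY 3).1 hb⟩


/-- **`n_X = 6` is dead for every `m`** (rank 2, locally free, small-charge regime).  `n_X = 4c_j² + w_j` with
`c_j ≥ 1`, `w_j ≥ 2` forces `c_j = 1`, `w_j = 2`: a single moving ribbon, so `d_j = 1` (isotropic-fibre test),
`m = 2c_jd_j = 2`, and then `6 ∣ 22m² + 6n_Y` fails. -/
theorem census_nX_six_dead (m nY c w d : ℤ) (hc : 1 ≤ c) (hw : 2 ≤ w) (hn : (6 : ℤ) = 4 * c ^ 2 + w)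
    (hribbon : w = 2 → d = 1) (hm : m = 2 * c * d) (hint : (6 : ℤ) ∣ 22 * m ^ 2 + 6 * nY) : False := by
  have hc1 : c = 1 := by nlinarith
  subst hc1
  have hw2 : w = 2 := by omega
  have hd := hribbon hw2
  subst hd
  have hm2 : m = 2 := by omega
  subst hm2
  omega

end GRR

/-! ## §N  Typed-crux v3 audit: the transfer stub is linear algebra (gen 4) -/

section Transfer

variable {K X Y : Type*} [CommRing K] [AddCommGroup X] [Module K X] [AddCommGroup Y] [Module K Y]

/-- **Transfer core (support lemma for `stub_mixedClassTransfer`, v3).**  `B_X`, `B_Y` the cup pairings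
on `H²(X)`, `H²(Y′)` (`B_X` separating), `Ψ : H²(Y′) → H²(X)` surjective with
`B_X(Ψy, Ψy′) = 2B_Y(y, y′)`, and `T : H²(Y′) → H²(X)`, `T′ : H²(X) → H²(Y′)` mutually adjoint
(`T y = Σ_i B_Y(y, g^*b_i)a_i`, `T′x = Σ_i B_X(x, a_i)g^*b_i` for `κ^{2,2} = Σ a_i ⊗ b_i`: projection
formula + Künneth).  If the address equation `T′ ∘ Ψ = −2m` holds then the carrier equation `T = −m·Ψ`
holds with the SAME `m` — the stub's `∃ m′ ≠ 0` is witnessed by `m′ = m`, over any coefficient ring. -/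
theorem transfer_core (BX : X →ₗ[K] X →ₗ[K] K) (BY : Y →ₗ[K] Y →ₗ[K] K)
    (hsep : ∀ x : X, (∀ z, BX x z = 0) → x = 0) (Ψ T : Y →ₗ[K] X) (T' : X →ₗ[K] Y)
    (hΨ : Function.Surjective Ψ) (hsim : ∀ y y', BX (Ψ y) (Ψ y') = 2 * BY y y')
    (hadj : ∀ y x, BX (T y) x = BY y (T' x)) (m : K) (haddr : ∀ y, T' (Ψ y) = (-(2 * m)) • y)
    (y : Y) : T y = (-m) • Ψ y := by
  have h0 : T y + m • Ψ y = 0 := by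
    refine hsep _ fun z => ?_
    obtain ⟨y', rfl⟩ := hΨ z
    simp only [map_add, map_smul, LinearMap.add_apply, LinearMap.smul_apply, smul_eq_mul, hadj,
      haddr, hsim]
    ring
  rw [neg_smul]
  exact eq_neg_iff_add_eq_zero.mpr h0

end Transfer


end Summit.HodgeConjecture.HodgeConjecture.Cruxes.NikulinSerreCarrier.Disproof
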